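import Summits.QuantumFields.YangMills.Theorems.CurvatureBoostCovariance.Negative.Unbundled
import Summits.QuantumFields.YangMills.Theorems.CurvatureBoostCovariance.Negative.OnAllTestsFalse
import Summits.QuantumFields.YangMills.Theorems.NPointIsotropy.Negative.NPointRegularJunk
import Summits.QuantumFields.YangMills.Theorems.NPointIsotropy.Negative.AngularBandLimitFalse
import Summits.QuantumFields.YangMills.Theorems.PencilRigidityNPointIsotropyBandlimit
import Literature.MathematicalPhysics.QuantumFieldTheory.OSLorentzInvariance
import Summits.QuantumFields.YangMills.Theorems.MirrorModularBoostsCurvatureBoostCovarianceTensorDensity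
import Summits.QuantumFields.YangMills.Theorems.MirrorModularBoostsCurvatureBoostCovarianceDoubledToInvariant
import Summits.QuantumFields.YangMills.Theorems.MirrorModularBoostsCurvatureBoostCovarianceRayPositivityCore
import Summits.QuantumFields.YangMills.Theorems.MirrorModularBoostsCurvatureBoostCovarianceRayPositivity
import Summits.QuantumFields.YangMills.Theorems.MirrorModularBoostsCurvatureBoostCovarianceOrbitGluing
import Summits.QuantumFields.YangMills.Theorems.MirrorModularBoostsCurvatureBoostCovarianceOrbitGenericUpgrade
import Summits.QuantumFields.YangMills.Theorems.MirrorModularBoostsCurvatureBoostCovarianceOrbitAllAngles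
import Summits.QuantumFields.YangMills.Theorems.MirrorModularBoostsCurvatureBoostCovarianceOrbitLocalContinuation
import Summits.QuantumFields.YangMills.Theorems.MirrorModularBoostsCurvatureBoostCovarianceOrbitBandlimit
import Summits.QuantumFields.YangMills.Theorems.MirrorModularBoostsCurvatureBoostCovarianceLevelGrowthLow
import Summits.QuantumFields.YangMills.Theorems.MirrorModularBoostsCurvatureBoostCovarianceParitySieve
import Summits.QuantumFields.YangMills.Theorems.MirrorModularBoostsCurvatureBoostCovarianceGramVecOnStrip
import Summits.QuantumFields.YangMills.Theorems.MirrorModularBoostsCurvatureBoostCovarianceOperatorConeFamily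
import Summits.QuantumFields.YangMills.Theorems.MirrorModularBoostsSoftKernelBoostCovarianceOrbitBandlimitLocal
import Summits.QuantumFields.YangMills.Theorems.MirrorModularBoostsSoftKernelBoostCovarianceRayPositivityLocal
-- (hub oleans pending) import Summits.QuantumFields.YangMills.Theorems.MirrorModularBoostsCurvatureBoostCovarianceDominatedTieLimit
-- (hub oleans pending) import Summits.QuantumFields.YangMills.Theorems.MirrorModularBoostsCurvatureBoostCovarianceRegularOfDominated
import Literature.MathematicalPhysics.QuantumFieldTheory.OSReconstructionNoE1
import Summits.QuantumFields.YangMills.Theses.PencilRigidity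
import Summits.QuantumFields.YangMills.Theorems.NPointIsotropy.Negative.DegreeTwoFree
import Summits.QuantumFields.YangMills.Theorems.MirrorModularBoostsPlanarSpectralCone
import Summits.QuantumFields.YangMills.Theorems.PencilRigidityShellRigidity

/-!
# Line `boosts-inherit-mirrors` — checked skeleton for crux `MirrorModularBoosts.CurvatureBoostCovariance`
(stmt-QuantumFields-9663; route-QuantumFields-MirrorModularBoosts; planner crux-plan, round 1, generation 1)

Idea card `Cruxes/CurvatureBoostCovariance/Ideas/boosts-inherit-mirrors.md` (triage r1: pass ×3); line card
`Lines/boosts-inherit-mirrors.md`.  Crux (landed `Negative.Unbundled.crux_iff`): for every compact simple `G`,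
`W1 r sch S₁ → EightFrameRP S₁ → PlanarCone S₁ → PlanarInvariant S₁`.

THE LINE IN ONE PARAGRAPH.  Currency between the stubs: the ORBIT FUNCTION `θ ↦ 𝔖_{n+m}(R_θ · H)` of a DOUBLED test
function `H = ΘF* ⊗ G` (`F`, `G` `e₀`-time-ordered, compactly supported; `R_θ = planeRot 0 θ`, the rotation of the
`(x₀,x₁)`-plane).  Stub 3 makes it a trigonometric polynomial `Σ_{|k|≤K} c_k e^{4ikθ}` (entire continuation in the
complex angle from the planar cone + quarter-turn periodicity + Paley–Wiener + the Step-0 function residual).  Its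
LAURENT PENCIL `s ↦ Σ c_k s^k` is, at `s = e^{-4χ} > 0`, the Gram form `⟨Ψ^χ_F, Ψ^χ_G⟩` of the vectors BOOSTED by
the rapidity `χ` in the `e₀`-reconstruction (`H_χ = cosh χ·H + sinh χ·P₁ ≥ e^{-|χ|} H ≥ 0` by the cone), and at
`s = -e^{-4χ} < 0` the same in the 45° frame (diagonal mirror RP + the cone of the 45° pull-back): BOOSTS INHERIT THE
MIRRORS, so the 2×2 pencil of the blocks `(F,F) (F,G) (G,F) (G,G)` is positive semidefinite on ALL of `ℝ∖0`
(stub 4, the lever).  The YM-specific input (stub 5, the card's Transfer `C⁺ = ∀a G_a`, consuming the lattice tie):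
at OS level `a`, given planar invariance in degrees `≤ 2a-2`, the diagonal pencil of a degree-`a` doubled block has
no layer `|k| ≥ 2` (growth `o(e^{8|χ|})` of `‖Ψ^χ_F‖²`: one squeezed pair of `tr F²` insertions costs at most its
dimension, softened; at `a = 1` this is the two-point UV bound `|K(x)| ≲ |x|^{η-10}` of `PencilRigidity.
CurvatureKernelBound` after transverse smearing, TRIAGE r1-1 App. B).  PARITY (`Sieve.paritySieve`, pure algebra,
PROVED sorry-free in this file): a PSD pencil on both half-lines with diagonal layers `≤ 1` has CONSTANT blocks —
`s^{±1}` changes sign across `0`, Cauchy–Schwarz bounds the off-diagonal block, a bounded Laurent polynomial is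
constant.  Hence every doubled orbit function is constant, level by level (induction on `a`, pure logic below), and
stub 6 (tensor density + a.e. change of variables under the function residual) turns doubled-orbit constancy into
`PlanarInvariant`.  The lattice tie enters at stub 1 (Step 0: every `𝔖ₙ|⁰𝒮` is a
function — the clause that kills the junk families) and at stub 5 (the UV input) and nowhere else.

STUBS (16 registered names after lead -0's reshapes 1–5; continuation lead gen 1, 2026-08-16: `stub_planarCone` (= 9664)
and `stub_shellRigidity` (= 11685) are now DISCHARGED BY IMPORT of their landed proofs; RESHAPE 8 (continuation lead c2,
2026-08-16): Step 0 `stub_tieRegularity` is PROVED from `stub_temperedLatticeApproximants` (YM input, lattice language) +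
`stub_dominatedTieLimit` + `stub_regular_of_dominated` (model-blind analysis, provable now) + E0; so the `sorry`s of this file
are SIX registered stubs — temperedLatticeApproximants, dominatedTieLimit, regular_of_dominated, doubledOrbitKernel,
curvatureKernelBound = 11687, levelGrowthHigh — of which THREE are honest Yang–Mills inputs and three are provable analysis):
* `stub_tieRegularity`      — Step 0, USES THE TIE: `W1 + EightFrameRP + PlanarCone ⇒ NPointRegular`.  RESHAPE 8: PROVED
                               from Stubs 1a `stub_temperedLatticeApproximants` (XL, YM), 1b `stub_dominatedTieLimit` (M–L),
                               1c `stub_regular_of_dominated` (M).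
* `stub_planarCone`         — = item stmt-QuantumFields-9664 `MirrorModularBoosts.PlanarSpectralCone` BY NAME
                               (needed a second time, for the 45° pull-backs: diagonal rays).  DISCHARGED: the landed
                               `PositivityDiscToOperatorCone.PlanarSpectralCone_of` (Theorems/MirrorModularBoostsPlanarSpectralCone).
* `stub_orbitGluing`, `stub_orbitGenericUpgrade`, `stub_orbitAllAngles`, `stub_orbitLocalContinuation` — (reshape 3)
                               the proved pieces of Stub 3 (gluing, a.e. upgrade, two frames, OS bookkeeping). M each
* `stub_orbitBandlimit`     — 4a ⇒ doubled orbit functions are trigonometric polynomials (proved wave 2).     L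
* `stub_uniformPlanarBoostVectors` — (reshapes 2–3) THE named analytic input of Stubs 3–4: boosted OS vectors,
                               holomorphic on a strip, exponential type uniform in the test function.  RESHAPE 6
                               (continuation lead c1): PROVED from the two stubs below.
* `stub_gramVecOnStrip`     — (reshape 6) holomorphic vectors from a sesqui-holomorphic Gram kernel on a strip
                               (abstract Hilbert space; `exists_holomorphic_gramVec` through `tan`).  M, provable now
* `stub_doubledOrbitKernel` — (reshape 6) THE analytic input in scalar form: the doubled orbit kernel
                               `(η',η) ↦ 𝔖_{2n}(Θ(R_{η'}F)* ⊗ R_η F)` is sesqui-holomorphic on a strip, diagonal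
                               growth `e^{2N|Im θ|}` (OS II without E1 along complex-rotation orbits).          XL
* `stub_rayPositivityCore`  — (reshape 2) identity theorem on a strip + Gram form (pure analysis; proved wave 1). M
* `stub_rayPositivity`      — THE LEVER (i): 4a ⇒ the 2×2 pencil is PSD for every real `s ≠ 0` (proved wave 1).  L
* `stub_curvatureKernelBound` — (reshape 4) PencilRigidity item 11687 BY NAME.                                  open item
* `stub_shellRigidity`      — (reshape 4) PencilRigidity item 11685 BY NAME.  DISCHARGED: 11685 is PROVED
                               (`TransverseSmearingPlanarThreshold.ShellRigidity_proof`, Theorems/PencilRigidityShellRigidity).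
* `stub_levelGrowthLow`     — (reshape 4) levels a ≤ 1 from 5₀ + 5₁ + landed KernelTransfer (provable now).  M
* `stub_levelGrowthHigh`    — THE TRANSFER `C⁺ = G_a` at levels a ≥ 2, USES THE TIE: THE BET, no engine.    XL (hardest)
* `stub_tensorDensity`      — (lead's reshape 1) du Bois-Reymond for appended tensor products on `U ×' V`.      M, provable now
* `stub_doubledToInvariant` — doubled-orbit constancy up to level `b` ⇒ invariance in degrees `≤ 2b`.          M–L, provable now
PROVED AND LANDED: `stub_paritySieve` (…ParitySieve.lean) — THE LEVER (ii): parity + Cauchy–Schwarz + "a bounded Laurent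
polynomial is constant", the card's `OddTopHarmonicVanishes` without its decorative hypotheses.
`CurvatureBoostCovariance_of` composes everything into the crux BY NAME; `sieve_of_stubs` is the model-blind part
(stubs 2,3,4,6 + the parity sieve, with the residual and the growth as hypotheses) — it shows exactly where the
lattice enters.
-/

noncomputable section

-- Mathlib's `SimplexCategory` instance `Fintype (Fin (x.len + 1))` matches `Fintype (Fin 4)` and makes concrete `Fin 4`
-- instance paths diverge between elaborations (tree-known file-local workaround, as in the landed `Negative/*.lean` files).
attribute [-instance] SimplexCategory.instFintypeToTypeOrderHomFinHAddNatLenOfNat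

namespace Summit.QuantumFields.YangMills.Cruxes.CurvatureBoostCovariance.BoostsInheritMirrors

open scoped BigOperators SchwartzMap InnerProductSpace
open MeasureTheory Filter Topology
open Literature.MathematicalPhysics.QuantumLattice Literature.MathematicalPhysics.AQFT
  Literature.MathematicalPhysics.QuantumFieldTheory
open Summit.QuantumFields.YangMills.Theorems.NPointIsotropy.Negative (E4 NPointRegular junk not_nPointRegular_junk)
open Summit.QuantumFields.YangMills.Theorems.CurvatureBoostCovariance.Negative
  (OSPackage Translations Hypercubic EightFrameRP PlanarCone PlanarInvariant Tie Gaps W1 crux_iff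
    CurvatureBoostCovarianceOnAllTests not_curvatureBoostCovarianceOnAllTests)

/-! ## The six stubs (each statement over importable tree vocabulary only, wrapped in its own `open … in`) -/

/-! ### Step 0 (Stub 1) RESHAPED — reshape 8, continuation lead c2, 2026-08-16

`stub_tieRegularity` (W1 + eight frames + cone ⇒ `NPointRegular`) is no longer a stub: it is PROVED below from three
registered stubs — ONE Yang–Mills input in lattice language and TWO model-blind analysis statements (provable now) — plus
E0 in degree `0`.  Currency: the RENORMALISED LATTICE MOMENT DENSITIES of the curvature channel at injective multi-sites,
`D_k(x) = c_kⁿ ∫ ∏ᵢ (O(τ_{xᵢ} Ũ) − m_k) dμ_{β_k}` (`O` = Wilson action density, torus of side `2L_k+1`), whose Riemann sums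
`(a_k⁴)ⁿ Σ_{x ∈ boxⁿ} ∏ᵢ fᵢ(a_k xᵢ) D_k(x)` ARE the lattice `n`-point functions `latticeSchwinger` of the tie (expand the
product of the smeared fields; non-injective multi-sites do not see off-diagonal tensors).  A TEMPERED weight
`w(y) = C (1 + ‖y‖)^N (1 + Σ_{i ≠ j} ‖yᵢ − yⱼ‖⁻¹)^N` is the expected UV/IR shape of `|D_k|` for a genuine Wilson limit of
`tr F²` (dimension `4`: `∏ d_{ij}^{-8}`-type blow-up at short physical distance, clustering at large), uniformly in `k`. -/

/-- **Stub 1a — TEMPERED LATTICE APPROXIMANTS: the Yang–Mills input of Step 0 (USES THE TIE; difficulty XL = a UV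
property of the Wilson limit, the `n`-point soft-exponent analogue of `PencilRigidity.CurvatureKernelBound`; registered
at reshape 8 by the continuation lead c2, 2026-08-16).**  For every compact simple `G`, `r`, `sch`, `S₁` with the curvature
package `W1 r sch S₁`, the eight planar frames and the planar cone, and every degree `n ≥ 1`: there are lattice densities
`D_k : (box 4 L_k)ⁿ → ℝ` on the scheme's tori, TEMPERED at injective multi-sites uniformly in `k ≥ k₀` —
`|D_k(x)| ≤ C (1 + ‖a_k x‖)^N (1 + Σ_{i ≠ j} ‖a_k xᵢ − a_k xⱼ‖⁻¹)^N` — whose Riemann sums converge to `S₁ n` on every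
off-diagonal real tensor `f₁ ⊗ ⋯ ⊗ fₙ ∈ ⁰𝒮`.  INTENDED WITNESS: the true renormalised moment densities
`D_k(x) = c_kⁿ ∫ ∏ᵢ (r.curvature.F (configShift (−xᵢ) (torusLift Ũ)) − m_k) d(wilsonMeasure r.ρ β_k)`, for which the
convergence clause IS the tie (`W1`'s first conjunct, after expanding `latticeSchwinger`) and the bound is UV temperedness
of the renormalised `tr F²` moments at non-coinciding points ("`tr F²` has a scaling dimension", every perturbative /
OPE expectation; `N = N(n)`).  WHY `∃ D` AND NOT THE TRUE DENSITIES: `W1` carries no non-triviality and does not pin the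
scheme — a strong-coupling scheme with a perverse multiplicative renormalisation `c_k = exp((log a_k⁻¹)²)` (allowed by the
tie on flat-touching tensors, Disproof §5 item 3) has a TRIVIAL tied limit but true densities `≍ c_k²` at adjacent sites,
violating every tempered bound; the existential absorbs exactly these junk schemes (witness `D ≡ κⁿ` or `0`, Disproof §2,
§6), as the crux's own conclusion constrains `S₁` only.  Certified inhabitants: `c ≡ 0` (`D = 0`), `β_k = 0` frequently
(`D = κⁿ`, `Negative.BetaZeroTie`), the vacuum.  Junk (`𝔖₄ = J`) violates it (it violates `NPointRegular`, which Stubs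
1b–1c derive from it).  Frames and cone are idle here (kept so that the statement is WEAKER than a `W1`-only version). -/
theorem stub_temperedLatticeApproximants :
    open Literature.MathematicalPhysics.QuantumLattice Literature.MathematicalPhysics.AQFT
      Literature.MathematicalPhysics.QuantumFieldTheory Literature.Probability.LatticeModels
      Summit.QuantumFields.YangMills.Theorems.CurvatureBoostCovariance.Negative
      Summit.QuantumFields.YangMills.Theorems.NPointIsotropy.Negative in
    ∀ (G : Type) [Group G] [TopologicalSpace G] [IsTopologicalGroup G] [CompactSpace G]
      [MeasurableSpace G] [BorelSpace G], IsCompactSimpleLieGroup G →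
      ∀ (r : LatticeRep G) (sch : SpeciesScheme (YMSpecies G)) (S₁ : SchwingerFamily E4),
        W1 r sch S₁ → EightFrameRP S₁ → PlanarCone S₁ →
        ∀ n : ℕ, 0 < n → ∃ (D : ℕ → (Fin n → Site 4) → ℝ) (C : ℝ) (N k₀ : ℕ), 0 < C ∧
          (∀ k : ℕ, k₀ ≤ k → ∀ x : Fin n → Site 4, (∀ i, x i ∈ box 4 (sch.L k)) → Function.Injective x →
            |D k x| ≤ C * (1 + ‖fun i => sch.a k • siteToE (x i)‖) ^ N *
              (1 + ∑ i, ∑ j ∈ Finset.univ.erase i,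
                ‖sch.a k • siteToE (x i) - sch.a k • siteToE (x j)‖⁻¹) ^ N) ∧
          ∀ (f : Fin n → SchwartzMap E4 ℝ) (F : SchwartzMap (Fin n → E4) ℂ),
            IsTensorOf F (fun i => ofRealTest (f i)) → IsOffDiagonal F →
            Filter.Tendsto (fun k => (((sch.a k ^ 4) ^ n *
              ∑ x ∈ Fintype.piFinset (fun _ : Fin n => box 4 (sch.L k)),
                (∏ i, f i (sch.a k • siteToE (x i))) * D k x : ℝ) : ℂ)) Filter.atTop (nhds (S₁ n F)) := by
  sorry

/-- **Stub 1b — THE DOMINATED TIE LIMIT (model-blind real analysis; difficulty M–L; registered at reshape 8; PROVED by the wave-1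
worker and LANDED as `Theorems/MirrorModularBoostsCurvatureBoostCovarianceDominatedTieLimit.lean`, p108509, with the product-box
Riemann sums in `…DominatedTieLimitRiemannSum.lean`, p108242).**
Let `T` be a continuous linear functional on `𝓢((ℝ⁴)ⁿ, ℂ)`, `n ≥ 1`; `a_k > 0`, `a_k → 0`, `L_k ∈ ℕ` with `a_k L_k → ∞`;
`D_k : (ℤ⁴)ⁿ → ℝ` lattice densities and `w ≥ 0` a weight, measurable, continuous off the coincidence locus
`A = {y | ∃ i ≠ j, yᵢ = yⱼ}` and tempered there (`w y ≤ C (1 + ‖y‖)^N (1 + Σ_{i ≠ j} ‖yᵢ − yⱼ‖⁻¹)^N`), with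
`|D_k(x)| ≤ w(a_k x)` at injective multi-sites of the box for `k ≥ k₀`.  IF the Riemann sums
`Λ_k(F) = (a_k⁴)ⁿ Σ_{x ∈ boxⁿ} F(a_k x) D_k(x)` converge to `T F` on every off-diagonal real tensor `F = f₁ ⊗ ⋯ ⊗ fₙ`, THEN for
EVERY `F ∈ ⁰𝒮` (`IsOffDiagonal`): `‖F‖·w` is integrable and `‖T F‖ ≤ ∫ ‖F‖ w`.  Proof on offer: (1) equicontinuity of `Λ_k` on
`⁰𝒮` for the Schwartz topology — a flat `G ∈ ⁰𝒮` obeys `|G(y)| w(y) ≤ C' p(G) (1 + ‖y‖)^{-4n-1}` (weighted flatness at the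
coincidence locus, `dist(y, A) ≤ ‖yᵢ − yⱼ‖`: the landed `one_add_pow_mul_norm_iteratedFDeriv_le` of
`Theorems/PencilRigidityNPointIsotropyOffDiagCutoffTendsto.lean`) and `(a⁴)ⁿ Σ_{x ∈ (ℤ⁴)ⁿ} (1 + ‖a x‖)^{-4n-1} ≤ C''` for
`a ≤ 1`; non-injective multi-sites do not contribute (`IsOffDiagonal.apply_eq_zero`); (2) hence `Λ_k F → T F` on the
Schwartz-closure of the span of the off-diagonal real tensors, which is all of `⁰𝒮` (landed `offDiagDensity` /
`localOffDiagDensity` / `tendsto_smulLeftCLM_of_isOffDiagonal`, `Theorems/PencilRigidityNPointIsotropyOffDiag*.lean`);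
(3) `‖Λ_k F‖ ≤ (a_k⁴)ⁿ Σ ‖F(a_k x)‖ w(a_k x) → ∫ ‖F‖ w` — Riemann sums over the exploding fine boxes of the continuous
integrand `‖F‖ w` (continuous across `A` by flatness, majorant `(1 + ‖y‖)^{-4n-1}`; product-box version of the landed
`tendsto_riemannSum_box`, `Theorems/PencilRigidityNPointIsotropyRiemannSum.lean`). -/
theorem stub_dominatedTieLimit :
    open Literature.MathematicalPhysics.QuantumLattice Literature.MathematicalPhysics.AQFT
      Literature.Probability.LatticeModels
      Summit.QuantumFields.YangMills.Theorems.NPointIsotropy.Negative in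
    ∀ (n : ℕ), 0 < n → ∀ (T : SchwartzMap (Fin n → E4) ℂ →L[ℂ] ℂ) (a : ℕ → ℝ) (L : ℕ → ℕ)
      (D : ℕ → (Fin n → Site 4) → ℝ) (w : (Fin n → E4) → ℝ) (C : ℝ) (N k₀ : ℕ),
      (∀ k, 0 < a k) → Filter.Tendsto a Filter.atTop (nhds 0) →
      Filter.Tendsto (fun k => a k * L k) Filter.atTop Filter.atTop →
      Measurable w → ContinuousOn w (coincidenceLocus n E4)ᶜ → (∀ y, 0 ≤ w y) →
      (∀ y ∉ coincidenceLocus n E4,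
        w y ≤ C * (1 + ‖y‖) ^ N * (1 + ∑ i, ∑ j ∈ Finset.univ.erase i, ‖y i - y j‖⁻¹) ^ N) →
      (∀ k, k₀ ≤ k → ∀ x : Fin n → Site 4, (∀ i, x i ∈ box 4 (L k)) → Function.Injective x →
        |D k x| ≤ w (fun i => a k • siteToE (x i))) →
      (∀ (f : Fin n → SchwartzMap E4 ℝ) (F : SchwartzMap (Fin n → E4) ℂ),
        IsTensorOf F (fun i => ofRealTest (f i)) → IsOffDiagonal F →
        Filter.Tendsto (fun k => (((a k ^ 4) ^ n * ∑ x ∈ Fintype.piFinset (fun _ : Fin n => box 4 (L k)),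
          (∏ i, f i (a k • siteToE (x i))) * D k x : ℝ) : ℂ)) Filter.atTop (nhds (T F))) →
      ∀ F : SchwartzMap (Fin n → E4) ℂ, IsOffDiagonal F →
        MeasureTheory.Integrable (fun y : Fin n → E4 => ‖F y‖ * w y) ∧ ‖T F‖ ≤ ∫ y : Fin n → E4, ‖F y‖ * w y := by
  -- LANDED (p108509): `Summit.QuantumFields.YangMills.Theorems.CurvatureBoostCovariance.BoostsInheritMirrors.stub_dominatedTieLimit`;
  -- kept as `sorry` until the hub has the olean of its module (import commented out above).
  sorry

/-- **Stub 1c — AN `L¹(w)`-DOMINATED FUNCTIONAL ON `⁰𝒮` IS A FUNCTION (model-blind functional analysis; difficulty M;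
registered at reshape 8; PROVED by the wave-1 worker and LANDED as
`Theorems/MirrorModularBoostsCurvatureBoostCovarianceRegularOfDominated.lean`, p109000).**  If a continuous linear functional `T` on `𝓢((ℝ⁴)ⁿ, ℂ)` satisfies
`‖T F‖ ≤ ∫ ‖F‖ w` for every `F ∈ ⁰𝒮`, with `w ≥ 0` measurable and tempered off the coincidence locus, then `T|⁰𝒮` is
integration against a function: `∃ W, ∀ F ∈ ⁰𝒮, W·F ∈ L¹ ∧ T F = ∫ W·F` (the degree-`n` clause of `NPointRegular`).
Proof on offer (Hilbert space, no Riesz–Markov): with `v = w² (1 + ‖y‖)^{4n+1}` (and `v = 0` where `w = 0`),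
Cauchy–Schwarz gives `∫ ‖F‖ w ≤ K ‖F √v‖_{L²}` (`K² = ∫ (1 + ‖y‖)^{-4n-1}`), and `F √v ∈ L²` for flat `F` (weighted
flatness again); so `F ↦ T F` factors through the class of `F` in `L²(v dy)` (`MeasureTheory.Lp ℂ 2 (volume.withDensity v)`:
if two flat `F, F'` agree `v dy`-a.e. then `∫ ‖F − F'‖ w = 0`), is bounded there by `K`, extends from the range subspace
(Hahn–Banach `exists_extension_norm_eq`, or the orthogonal projection onto its closure) and is represented by Riesz
(`InnerProductSpace.toDual`) by some `ξ ∈ L²(v dy)`: `T F = ∫ conj ξ · F · v dy`, i.e. `W = conj ξ · v`, with `W·F ∈ L¹`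
by Hölder.  Consistent with every inhabitant (`T = κⁿ dy`: `W = κⁿ`). -/
theorem stub_regular_of_dominated :
    open Literature.MathematicalPhysics.QuantumLattice Literature.MathematicalPhysics.AQFT
      Summit.QuantumFields.YangMills.Theorems.NPointIsotropy.Negative in
    ∀ (n : ℕ) (T : SchwartzMap (Fin n → E4) ℂ →L[ℂ] ℂ) (w : (Fin n → E4) → ℝ) (C : ℝ) (N : ℕ),
      Measurable w → (∀ y, 0 ≤ w y) →
      (∀ y ∉ coincidenceLocus n E4,
        w y ≤ C * (1 + ‖y‖) ^ N * (1 + ∑ i, ∑ j ∈ Finset.univ.erase i, ‖y i - y j‖⁻¹) ^ N) →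
      (∀ F : SchwartzMap (Fin n → E4) ℂ, IsOffDiagonal F →
        MeasureTheory.Integrable (fun y : Fin n → E4 => ‖F y‖ * w y) ∧
          ‖T F‖ ≤ ∫ y : Fin n → E4, ‖F y‖ * w y) →
      ∃ W : (Fin n → E4) → ℂ, ∀ F : SchwartzMap (Fin n → E4) ℂ, IsOffDiagonal F →
        MeasureTheory.Integrable (fun y : Fin n → E4 => W y * F y) ∧ T F = ∫ y : Fin n → E4, W y * F y := by
  -- LANDED (p109000): `Summit.QuantumFields.YangMills.Theorems.CurvatureBoostCovariance.BoostsInheritMirrors.stub_regular_of_dominated`;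
  -- kept as `sorry` until the hub has the olean of its module (import commented out above).
  sorry

/-- The Step-0 function residual in degree `0` is E0 (`W₀ ≡ 1`; Lebesgue measure on `Fin 0 → ℝ⁴` is the Dirac mass).
Inlined from the landed `Theorems/PencilRigidityNPointIsotropyDegreeOneTie.lean` (`residual_zero`, lead of crux 11686)
so that this file does not depend on that module's hub build. -/
theorem residual_zero (S₁ : SchwingerFamily E4) (h0 : S₁.toLabelled.IsNormalized) :
    ∃ W : (Fin 0 → E4) → ℂ, ∀ F : 𝓢((Fin 0 → E4), ℂ), IsOffDiagonal F →
      Integrable (fun x : Fin 0 → E4 => W x * F x) ∧ S₁ 0 F = ∫ x : Fin 0 → E4, W x * F x := by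
  have hvol : (volume : Measure (Fin 0 → E4)) = Measure.dirac default := by
    rw [MeasureTheory.volume_pi]
    exact Measure.pi_of_empty _ default
  refine ⟨fun _ => 1, fun F _ => ?_⟩
  simp only [one_mul]
  refine ⟨?_, ?_⟩
  · rw [hvol]
    exact (integrable_const (F default)).congr (ae_eq_dirac (F : (Fin 0 → E4) → ℂ)).symm
  · rw [hvol, integral_dirac]
    exact (h0 (fun _ => ()) F).trans (congrArg F (Subsingleton.elim _ _))

open Literature.Probability.LatticeModels (Site box) in
/-- **Stub 1 — Step 0 (`W1 + EightFrameRP + PlanarCone ⇒ NPointRegular`), PROVED from Stubs 1a–1c (reshape 8).**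
Degree `0` is E0 (`residual_zero`); in degree `n ≥ 1` Stub 1a supplies tempered lattice approximants `D_k` tied to
`S₁ n`, read against the continuum weight `w(y) = C (1 + ‖y‖)^N (1 + Σ_{i ≠ j} ‖yᵢ − yⱼ‖⁻¹)^N` (measurable, nonnegative,
continuous off the coincidence locus), Stub 1b turns the tie into the domination `‖S₁ n F‖ ≤ ∫ ‖F‖ w` on `⁰𝒮`, and
Stub 1c turns domination into a representing function.  This is the twin of the Step-0 stub of
`Cruxes/NPointIsotropy/Lines/complex-rotation-bandlimit.lean` (there with the radial kernel in place of the cone); the junk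
family is excluded exactly here (`not_nPointRegular_junk`). -/
theorem stub_tieRegularity :
    open Literature.MathematicalPhysics.QuantumLattice Literature.MathematicalPhysics.AQFT
      Literature.MathematicalPhysics.QuantumFieldTheory
      Summit.QuantumFields.YangMills.Theorems.CurvatureBoostCovariance.Negative
      Summit.QuantumFields.YangMills.Theorems.NPointIsotropy.Negative in
    ∀ (G : Type) [Group G] [TopologicalSpace G] [IsTopologicalGroup G] [CompactSpace G]
      [MeasurableSpace G] [BorelSpace G], IsCompactSimpleLieGroup G →
      ∀ (r : LatticeRep G) (sch : SpeciesScheme (YMSpecies G)) (S₁ : SchwingerFamily E4),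
        W1 r sch S₁ → EightFrameRP S₁ → PlanarCone S₁ → NPointRegular S₁ := by
  intro G _ _ _ _ _ _ hG r sch S₁ hW h8 hC n
  rcases Nat.eq_zero_or_pos n with rfl | hn
  · exact residual_zero S₁ hW.2.1.1
  obtain ⟨D, C, N, k₀, hCpos, hbound, htie⟩ := stub_temperedLatticeApproximants G hG r sch S₁ hW h8 hC n hn
  -- the tempered weight of Stub 1a, read on continuum configurations
  have hcont : ContinuousOn (fun y : Fin n → E4 => C * (1 + ‖y‖) ^ N *
      (1 + ∑ i, ∑ j ∈ Finset.univ.erase i, ‖y i - y j‖⁻¹) ^ N) (coincidenceLocus n E4)ᶜ := by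
    refine (continuousOn_const.mul ((continuousOn_const.add continuous_norm.continuousOn).pow N)).mul
      ((continuousOn_const.add (continuousOn_finsetSum _ fun i _ =>
        continuousOn_finsetSum _ fun j hj => ?_)).pow N)
    have hne : ∀ y ∈ (coincidenceLocus n E4)ᶜ, ‖y i - y j‖ ≠ 0 := fun y hy h =>
      hy ⟨i, j, (Finset.ne_of_mem_erase hj).symm, sub_eq_zero.1 (norm_eq_zero.1 h)⟩
    exact ContinuousOn.inv₀ (by fun_prop) hne
  have hmeas : Measurable (fun y : Fin n → E4 => C * (1 + ‖y‖) ^ N *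
      (1 + ∑ i, ∑ j ∈ Finset.univ.erase i, ‖y i - y j‖⁻¹) ^ N) := by
    fun_prop
  have hnn : ∀ y : Fin n → E4, 0 ≤ C * (1 + ‖y‖) ^ N *
      (1 + ∑ i, ∑ j ∈ Finset.univ.erase i, ‖y i - y j‖⁻¹) ^ N := fun y =>
    mul_nonneg (mul_nonneg hCpos.le (by positivity)) (by positivity)
  -- Stubs 1b + 1c
  exact stub_regular_of_dominated n (S₁ n) _ C N hmeas hnn (fun y _ => le_rfl)
    (stub_dominatedTieLimit n hn (S₁ n) sch.a sch.L D _ C N k₀ sch.a_pos sch.tendsto_a sch.tendsto_L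
      hmeas hcont hnn (fun y _ => le_rfl) hbound htie)

/-- **Stub 2 — the planar spectral cone as a THEOREM about every eight-frame family (difficulty L; this is the
shared route item stmt-QuantumFields-9664 `MirrorModularBoosts.PlanarSpectralCone`, stated BY NAME; DISCHARGED
2026-08-16 by the landed proof of line `positivity-disc-to-operator-cone` of that crux).**  The crux hands over the cone of `S₁` itself (`PlanarCone S₁`, used for the axis rays `s > 0`); the
diagonal rays `s < 0` of stub 4 need the cone of the 45° pull-backs `S₁ ∘ (R_{π/4} ·)`, which are again eight-frame
families (the eight time axes are permuted by `R_{π/4}`) but are not related to `S₁` by any available symmetry —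
so the universal statement is consumed a second time, honestly, here. -/
theorem stub_planarCone :
    Summit.QuantumFields.YangMills.Theses.MirrorModularBoosts.PlanarSpectralCone :=
  Summit.QuantumFields.YangMills.Cruxes.PlanarSpectralCone.PositivityDiscToOperatorCone.PlanarSpectralCone_of

/-- **Stub 3a — GLUING (pure complex analysis; difficulty M; PROVED by the wave-2 worker, registered at reshape 3 so that
its file can land).**  A `π/2`-periodic function on `ℝ` that near EVERY real point is the restriction of a function holomorphic
on a vertical strip, all of the same exponential type `Nₑ`, is the restriction of an ENTIRE function of exponential type `Nₑ`
(glue by the identity theorem; periodicity gives the uniform constant). -/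
theorem stub_orbitGluing :
    ∀ (f : ℝ → ℂ) (Nₑ : ℝ),
      (∀ t : ℝ, ∃ ε : ℝ, 0 < ε ∧ ∃ (Φ : ℂ → ℂ) (C : ℝ),
        DifferentiableOn ℂ Φ {w : ℂ | |w.re - t| < ε} ∧
        (∀ w : ℂ, |w.re - t| < ε → ‖Φ w‖ ≤ C * Real.exp (Nₑ * |w.im|)) ∧
        ∀ s : ℝ, |s - t| < ε → Φ s = f s) →
      (∀ s : ℝ, f (s + Real.pi / 2) = f s) →
      ∃ (Φ : ℂ → ℂ) (C : ℝ), Differentiable ℂ Φ ∧ (∀ w : ℂ, ‖Φ w‖ ≤ C * Real.exp (Nₑ * |w.im|)) ∧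
        ∀ s : ℝ, Φ s = f s :=
  Summit.QuantumFields.YangMills.Theorems.CurvatureBoostCovariance.BoostsInheritMirrors.stub_orbitGluing

/-- **Stub 3b — THE A.E. UPGRADE under the function residual (difficulty M; PROVED by the wave-2 worker, registered at reshape
3).**  If a degree-`N` functional `T` is integration against a function on `⁰𝒮` and its planar orbit functions are trigonometric
polynomials of a FIXED degree `K` on every compactly supported test function supported in an open conull set `G` avoiding the
coincidence locus, then the same holds for every `F ∈ ⁰𝒮_N` (smooth exhaustion of `G`, dominated convergence, closedness of
degree-`≤ K` trigonometric polynomials under pointwise limits). -/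
theorem stub_orbitGenericUpgrade :
    open Literature.MathematicalPhysics.QuantumLattice Literature.MathematicalPhysics.AQFT
      Literature.MathematicalPhysics.QuantumFieldTheory
      Summit.QuantumFields.YangMills.Theorems.CurvatureBoostCovariance.Negative
      Summit.QuantumFields.YangMills.Theorems.NPointIsotropy.Negative in
    ∀ (N : ℕ) (T : SchwartzMap (Fin N → E4) ℂ →L[ℂ] ℂ) (W : (Fin N → E4) → ℂ),
      (∀ F : SchwartzMap (Fin N → E4) ℂ, IsOffDiagonal F →
        MeasureTheory.Integrable (fun x => W x * F x) ∧ T F = ∫ x, W x * F x) →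
      ∀ (G : Set (Fin N → E4)), IsOpen G → MeasureTheory.volume Gᶜ = 0 → G ⊆ (coincidenceLocus N E4)ᶜ →
      ∀ (K : ℕ),
        (∀ F : SchwartzMap (Fin N → E4) ℂ, tsupport (F : (Fin N → E4) → ℂ) ⊆ G →
          HasCompactSupport (F : (Fin N → E4) → ℂ) →
          ∃ c : ℤ → ℂ, ∀ θ : ℝ, T (linActMulti (planeRot (0 : Fin 3) θ) F) =
            ∑ k ∈ Finset.Icc (-(K : ℤ)) K, c k * Complex.exp (4 * (k : ℂ) * (θ : ℂ) * Complex.I)) →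
        ∀ (F : SchwartzMap (Fin N → E4) ℂ), IsOffDiagonal F →
          ∃ c : ℤ → ℂ, ∀ θ : ℝ, T (linActMulti (planeRot (0 : Fin 3) θ) F) =
            ∑ k ∈ Finset.Icc (-(K : ℤ)) K, c k * Complex.exp (4 * (k : ℂ) * (θ : ℂ) * Complex.I) :=
  Summit.QuantumFields.YangMills.Theorems.CurvatureBoostCovariance.BoostsInheritMirrors.stub_orbitGenericUpgrade

/-- **Stub 3c — FROM THE `e₀`-FRAME AT ANGLE `0` TO EVERY ANGLE (two frames and a smooth two-set partition; difficulty M;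
PROVED by the wave-2 worker, registered at reshape 3).**  If orbit functions of compactly supported test functions with
`e₀`-generic support (pairwise distinct times) extend holomorphically near the angle `0` with a uniform type, then for a
compactly supported `X` whose support is PLANAR-generic (at every angle the rotated configuration has pairwise distinct `x₀`- or
pairwise distinct `x₁`-coordinates) the orbit extends holomorphically near EVERY angle `θ₀` (rotate by `θ₀`; where the
`x₀`-coordinates fail use the quarter turn, which lies in `Hypercubic`). -/
theorem stub_orbitAllAngles :
    open Literature.MathematicalPhysics.QuantumLattice Literature.MathematicalPhysics.AQFT
      Literature.MathematicalPhysics.QuantumFieldTheory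
      Summit.QuantumFields.YangMills.Theorems.CurvatureBoostCovariance.Negative
      Summit.QuantumFields.YangMills.Theorems.NPointIsotropy.Negative in
    ∀ (N : ℕ) (S₁ : SchwingerFamily E4), Hypercubic S₁ → ∀ (Nₑ : ℝ),
      (∀ X : SchwartzMap (Fin N → E4) ℂ, HasCompactSupport (X : (Fin N → E4) → ℂ) →
        tsupport (X : (Fin N → E4) → ℂ) ⊆ {x | ∀ i j : Fin N, i ≠ j → x i 0 ≠ x j 0} →
        ∃ ε : ℝ, 0 < ε ∧ ∃ (Φ : ℂ → ℂ) (C : ℝ), DifferentiableOn ℂ Φ {w : ℂ | |w.re| < ε} ∧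
          (∀ w : ℂ, |w.re| < ε → ‖Φ w‖ ≤ C * Real.exp (Nₑ * |w.im|)) ∧
          ∀ θ : ℝ, |θ| < ε → Φ θ = S₁ N (linActMulti (planeRot (0 : Fin 3) θ) X)) →
      ∀ (X : SchwartzMap (Fin N → E4) ℂ), HasCompactSupport (X : (Fin N → E4) → ℂ) →
        (∀ x ∈ tsupport (X : (Fin N → E4) → ℂ), ∀ φ : ℝ,
          (∀ i j : Fin N, i ≠ j → (planeRot (0 : Fin 3) φ (x i)) 0 ≠ (planeRot (0 : Fin 3) φ (x j)) 0) ∨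
          (∀ i j : Fin N, i ≠ j → (planeRot (0 : Fin 3) φ (x i)) 1 ≠ (planeRot (0 : Fin 3) φ (x j)) 1)) →
        ∀ (θ₀ : ℝ),
          ∃ ε : ℝ, 0 < ε ∧ ∃ (Φ : ℂ → ℂ) (C : ℝ), DifferentiableOn ℂ Φ {w : ℂ | |w.re - θ₀| < ε} ∧
            (∀ w : ℂ, |w.re - θ₀| < ε → ‖Φ w‖ ≤ C * Real.exp (Nₑ * |w.im|)) ∧
            ∀ θ : ℝ, |θ - θ₀| < ε → Φ θ = S₁ N (linActMulti (planeRot (0 : Fin 3) θ) X) :=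
  Summit.QuantumFields.YangMills.Theorems.CurvatureBoostCovariance.BoostsInheritMirrors.stub_orbitAllAngles

/-- **Stub 3d — LOCAL ORBIT CONTINUATION FROM BOOST VECTORS (`e₀`-frame, angle `0`; pure OS bookkeeping, no analytic
continuation; difficulty M; PROVED by the wave-2 worker, registered at reshape 3).**  For a one-species family with E2 along
`e₀`, translations and E3, IF uniform planar boost vectors are given for `(S₁, h)` (the conclusion of Stub 4a at `S₁`, as a
hypothesis), THEN for every degree `N` there is a type `Nₑ` such that for every compactly supported `X` of degree `N` with
`e₀`-generic support the orbit `θ ↦ 𝔖_N(R_θ · X)` is, for `|θ| < ε`, the restriction of a function holomorphic on `{|Re w| < ε}`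
with `‖Φ w‖ ≤ C e^{Nₑ|Im w|}` (chamber decomposition of the support, E3 + translations to time-order each piece, vacuum pairing
`𝔖_N(Z) = ⟪Ω, Ψ_Z⟫`). -/
theorem stub_orbitLocalContinuation :
    open Literature.MathematicalPhysics.QuantumLattice Literature.MathematicalPhysics.AQFT
      Literature.MathematicalPhysics.QuantumFieldTheory
      Summit.QuantumFields.YangMills.Theorems.CurvatureBoostCovariance.Negative
      Summit.QuantumFields.YangMills.Theorems.NPointIsotropy.Negative in
    ∀ (S₁ : SchwingerFamily E4) (h : OSReconstructionNoE1 S₁.toLabelled), S₁.toLabelled.IsSymmetric →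
      (∀ (n : ℕ), ∃ N : ℝ, ∀ (F : SchwartzMap (Fin n → E4) ℂ), IsTimeOrdered F →
        HasCompactSupport (F : (Fin n → E4) → ℂ) →
        ∃ ε : ℝ, 0 < ε ∧ ∃ (V : ℂ → h.Hilbert) (C : ℝ),
          DifferentiableOn ℂ V {θ : ℂ | |θ.re| < ε} ∧
          (∀ θ : ℂ, |θ.re| < ε → ‖V θ‖ ≤ C * Real.exp (N * |θ.im|)) ∧
          ∀ θ : ℝ, |θ| < ε → ∀ hθ : IsTimeOrdered (linActMulti (planeRot (0 : Fin 3) θ) F),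
            V θ = h.fieldVec n (fun _ => ()) (linActMulti (planeRot (0 : Fin 3) θ) F) hθ) →
      ∀ (N : ℕ), ∃ Nₑ : ℝ, ∀ (X : SchwartzMap (Fin N → E4) ℂ), HasCompactSupport (X : (Fin N → E4) → ℂ) →
        tsupport (X : (Fin N → E4) → ℂ) ⊆ {x | ∀ i j : Fin N, i ≠ j → x i 0 ≠ x j 0} →
        ∃ ε : ℝ, 0 < ε ∧ ∃ (Φ : ℂ → ℂ) (C : ℝ),
          DifferentiableOn ℂ Φ {w : ℂ | |w.re| < ε} ∧
          (∀ w : ℂ, |w.re| < ε → ‖Φ w‖ ≤ C * Real.exp (Nₑ * |w.im|)) ∧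
          ∀ θ : ℝ, |θ| < ε → Φ θ = S₁ N (linActMulti (planeRot (0 : Fin 3) θ) X) :=
  Summit.QuantumFields.YangMills.Theorems.CurvatureBoostCovariance.BoostsInheritMirrors.stub_orbitLocalContinuation

/-- **Stub 3 — doubled orbit functions are trigonometric polynomials (model-blind analysis; difficulty XL as filed; RESHAPED by
the lead at reshape 3, 2026-08-16: the analytic input Stub 4a (uniform planar boost vectors) is the explicit first hypothesis,
and with it the stub is PROVED — wave-2 worker's 1443-line reduction, landing in five files via Stubs 3a–3d).**  For a
one-species family with the OS package (E0' temperedness, E3 symmetry, …), translation and proper hypercubic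
invariance on `⁰𝒮`, E2 in the eight planar frames, the planar cone and the Step-0 function residual, for all
compactly supported `e₀`-time-ordered `F` (degree `n`), `G` (degree `m`) and every witness `H` of `ΘF* ⊗ G`, the orbit
function `θ ↦ 𝔖_{n+m}(planeRot 0 θ · H)` is a trigonometric polynomial `Σ_{|k|≤K} c_k e^{4ikθ}` (some `K`, `c`; NO
uniformity of the degree in `F, G` is asked — the composition does not need it; the expected proof gives
`K = ⌊N(S₁,n+m)/4⌋` anyway).
Mechanism (card (iii) "caps", in the shape all three NPointIsotropy triagers passed): complexify the angle; for
`θ + iχ` the consecutive differences of `R_{θ+iχ}x` lie in the `e₀`-planar tube `{|Im Δζ¹| < Re Δζ⁰}` iff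
`Δ(R_θ x)⁰ > 0`, for EVERY real `χ` (`cosh χ > |sinh χ|`), likewise in the `e₁`-frame (quarter turn ∈ `Hypercubic`);
on planar-generic compact supports the strips glue to an ENTIRE `π/2`-periodic function of exponential type
`N(S₁, n+m)` (tempered growth of the multi-slot continuation — OS II without rotations, cone in multi-slot form via
`OSReconstructionNoE1`), hence a trig polynomial of degree `⌊N/4⌋` by the LANDED Paley–Wiener lemma
`Theorems/PencilRigidityNPointIsotropyBandlimit.lean` (`ComplexRotationBandlimit.stub_bandlimit`); the function
residual upgrades "generic compact supports" to all compactly supported off-diagonal `H` (isotypic decomposition of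
`Wₙ` a.e.; closed graph gives the local `L¹` control of `Wₙ` against rotation-swept flat envelopes), in particular to
doubled supports, which need not be planar-generic from degree `2 + 2` on.  Why the residual is a hypothesis: for ALL
off-diagonal `F` and no residual the band limit is FALSE (`NPointIsotropy.Negative.Triage3.not_AngularBandLimit`, the
junk family).  Consistent with every controlled scheme (`Wₙ ∈ {0, κⁿ}`: constant orbit functions, `K = 0`). -/
theorem stub_orbitBandlimit :
    open Literature.MathematicalPhysics.QuantumLattice Literature.MathematicalPhysics.AQFT
      Literature.MathematicalPhysics.QuantumFieldTheory
      Summit.QuantumFields.YangMills.Theorems.CurvatureBoostCovariance.Negative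
      Summit.QuantumFields.YangMills.Theorems.NPointIsotropy.Negative in
    (∀ (S₁ : SchwingerFamily E4) (h : OSReconstructionNoE1 S₁.toLabelled),
      S₁.toLabelled.HasLinearGrowth → S₁.toLabelled.IsSymmetric → EightFrameRP S₁ → PlanarCone S₁ →
      ∀ (n : ℕ), ∃ N : ℝ, ∀ (F : SchwartzMap (Fin n → E4) ℂ), IsTimeOrdered F →
        HasCompactSupport (F : (Fin n → E4) → ℂ) →
        ∃ ε : ℝ, 0 < ε ∧ ∃ (V : ℂ → h.Hilbert) (C : ℝ),
          DifferentiableOn ℂ V {θ : ℂ | |θ.re| < ε} ∧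
          (∀ θ : ℂ, |θ.re| < ε → ‖V θ‖ ≤ C * Real.exp (N * |θ.im|)) ∧
          ∀ θ : ℝ, |θ| < ε → ∀ hθ : IsTimeOrdered (linActMulti (planeRot (0 : Fin 3) θ) F),
            V θ = h.fieldVec n (fun _ => ()) (linActMulti (planeRot (0 : Fin 3) θ) F) hθ) →
    ∀ (S₁ : SchwingerFamily E4), OSPackage S₁ → Translations S₁ → Hypercubic S₁ → EightFrameRP S₁ →
      PlanarCone S₁ → NPointRegular S₁ →
      ∀ (n m : ℕ) (F : SchwartzMap (Fin n → E4) ℂ) (G : SchwartzMap (Fin m → E4) ℂ),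
        IsTimeOrdered F → IsTimeOrdered G →
        HasCompactSupport (F : (Fin n → E4) → ℂ) → HasCompactSupport (G : (Fin m → E4) → ℂ) →
        ∀ H : SchwartzMap (Fin (n + m) → E4) ℂ, IsAppendTensorOf H (osAdjoint F) G →
          ∃ (K : ℕ) (c : ℤ → ℂ), ∀ θ : ℝ,
            S₁ (n + m) (linActMulti (planeRot (0 : Fin 3) θ) H) =
              ∑ k ∈ Finset.Icc (-(K : ℤ)) K, c k * Complex.exp (4 * (k : ℂ) * (θ : ℂ) * Complex.I) :=
  Summit.QuantumFields.YangMills.Theorems.CurvatureBoostCovariance.BoostsInheritMirrors.stub_orbitBandlimit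

/-- **Stub 4a-i — HOLOMORPHIC VECTORS FROM A SESQUI-HOLOMORPHIC GRAM KERNEL ON A STRIP (abstract Hilbert space; pure
complex analysis; model-blind; difficulty M; registered by the continuation lead c1 at reshape 6, 2026-08-16; PROVED by the
wave-1 worker and LANDED as `Theorems/MirrorModularBoostsCurvatureBoostCovarianceGramVecOnStrip.lean`, p97780).**
Let `Φ : ℝ → H` be vectors attached to the real points of the strip `{|Re z| < ε}` and `K` a function of two complex
variables, jointly holomorphic on the square of the strip, with `⟪Φ η', Φ η⟫ = K(η', η)` at real points `|η|, |η'| < ε`.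
Then there is `Ψ : ℂ → H`, holomorphic on the strip, equal to `Φ` at the real points, with `⟪Ψ w, Ψ z⟫ = K(w̄, z)` on the
whole strip (so `‖Ψ z‖² = Re K(z̄, z)`).  This is the tree's `exists_holomorphic_gramVec`
(`Literature/MathematicalPhysics/QuantumFieldTheory/OSHolomorphicVectors.lean`, OS II Ch. V.2 (5.16)–(5.21) in abstract
form: real-centred polydiscs) transported through the biholomorphism `z ↦ tan(π z / (4ε))` of the strip onto the unit disc
(a real-centred disc; it maps the real segment `(-ε, ε)` onto the diameter `(-1, 1)` and commutes with complex conjugation;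
inverse `u ↦ (4ε/π) · (2i)⁻¹ log((1 + iu)/(1 - iu))`, `Re (1+iu)/(1-iu) = (1 - |u|²)/|1 - iu|² > 0` on the disc). -/
theorem stub_gramVecOnStrip :
    ∀ (H : Type) [NormedAddCommGroup H] [InnerProductSpace ℂ H] [CompleteSpace H] (ε : ℝ), 0 < ε →
      ∀ (Φ : ℝ → H) (K : ℂ → ℂ → ℂ),
        DifferentiableOn ℂ (Function.uncurry K) ({z : ℂ | |z.re| < ε} ×ˢ {z : ℂ | |z.re| < ε}) →
        (∀ η η' : ℝ, |η| < ε → |η'| < ε → ⟪Φ η', Φ η⟫_ℂ = K η' η) →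
        ∃ Ψ : ℂ → H, DifferentiableOn ℂ Ψ {z : ℂ | |z.re| < ε} ∧
          (∀ η : ℝ, |η| < ε → Ψ η = Φ η) ∧
          ∀ w z : ℂ, |w.re| < ε → |z.re| < ε → ⟪Ψ w, Ψ z⟫_ℂ = K (starRingEnd ℂ w) z :=
  Summit.QuantumFields.YangMills.Theorems.CurvatureBoostCovariance.BoostsInheritMirrors.stub_gramVecOnStrip

/-! ### Stub 4a-ii RESHAPED — reshape 9, continuation lead c2, 2026-08-16

The doubled orbit kernel (the scalar analytic input of Stub 4a) is now stated for the GIVEN family with the KERNEL TRIPLE of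
`S₁ 2` (real kernel `K`, continuous off `0`, `|K x| ≤ C (1 + ‖x‖^(η-10))`, representing `S₁ 2` on `⁰𝒮` — verbatim the extra
hypothesis of `SoftKernelBoostCovariance` and the conclusion of item 11687 `CurvatureKernelBound`, so the crux's families HAVE
it) and SPLIT BY DEGREE: degree `0` is trivial (`doubledOrbitKernel_zero`), degree `1` is PROVABLE NOW through SHARP ONE-POINT
VECTORS (Stub 4a-ii-α `stub_sharpOnePointVectors` + Stub 4a-ii-β `stub_doubledOrbitKernelOne`: with a continuous two-point kernel
the vectors `Φ_c = lim_{r→0} Ψ_{τ_c ρ_r}` exist, `Ψ_f = ∫ f(c) Φ_c dc`, and the operator cone family `N(ζ, β) = e^{-ζH + iβP₁}`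
(landed, with its semigroup law) boosts ONE slot: `V(θ) = ∫ f(c) N(R_θ c − c₀(θ)) U(c⊥) Φ_{c₀(θ)} dc` is holomorphic on the whole
strip, of exponential type `(10 − η)/2` — the UV degree of the kernel IS the type), degrees `≥ 2` remain the multi-slot OS-II
continuation without E1 (Stub 4a-ii-γ `stub_doubledOrbitKernelHigh`, XL).  The universal model-blind form of reshape 6 is
retired: the sieve below consumes boost vectors for `S₁` and its `45°` pull-back only, through the LOCAL band-limit and
ray-positivity theorems landed by the lead of 14999 (`…SoftKernelBoostCovarianceOrbitBandlimitLocal/RayPositivityLocal`). -/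

/-- **Stub 4a-ii-α — SHARP ONE-POINT VECTORS FROM A CONTINUOUS TWO-POINT KERNEL (model-blind Hilbert-space analysis over
`OSReconstructionNoE1`; difficulty M–L; PROVABLE NOW; registered at reshape 9).**  Let `S₁` have an `e₀`-reconstruction `h`
(E2 along `e₀` + translations on `⁰𝒮`) and the kernel triple: `S₁ 2 F = ∫ K(x₀ − x₁) F(x) dx` on `⁰𝒮` with `K` real,
continuous on `ℝ⁴ ∖ 0`, `|K x| ≤ C (1 + ‖x‖^(η−10))`.  Then there are SHARP VECTORS `Φ_c ∈ h.Hilbert` at the points `c` of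
the open half-space `{c⁰ > 0}` ("`e^{-c⁰H} U(c⃗) φ(0) Ω`") with: `c ↦ Φ_c` continuous there; `‖Φ_c‖² ≤ C (1 + (2c⁰)^(η−10))`
(indeed `‖Φ_c‖² = K(θc − c) = K(−2c⁰ e₀)`); covariance `Φ_{c + t e₀ + a⃗} = e^{-tH} U(a⃗) Φ_c` (`t ≥ 0`, `a⁰ = 0`); and every
compactly supported time-ordered one-point field vector is their Bochner integral, `Ψ_f = ∫ f(c) Φ_c dc`.  Proof on offer:
with a RADIAL bump `ρ_r` of radius `r` (mass `1`), `Φ_c := lim_{r → 0} Ψ_{τ_c ρ_r}` — Cauchy in `h.Hilbert` because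
`⟪Ψ_{τ_c ρ_r}, Ψ_{τ_c ρ_{r'}}⟫ = ∫∫ ρ_r ρ_{r'} K(θ(c + y) − (c + x)) dx dy → K(θc − c)` by continuity of `K` at `θc − c ≠ 0`
(`h.inner_fieldVec_fieldVec` + the kernel representation; `Θ(τ_c ρ_r)* ⊗ τ_c ρ_{r'}` is off-diagonal: disjoint supports);
continuity in `c` and the norm identity by the same computation; covariance from `h.transfer_fieldVec` / `h.translate_fieldVec`
(`e^{-tH}`, `U(a⃗)` translate test functions by `+t e₀`, `+a⃗`: `translateMulti_apply`) passed to the limit; the integral formula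
by testing against the total set of one-point vectors `Ψ_g` (both sides lie in their closed span; `⟪Ψ_g, Φ_c⟫ =
∫ conj g(y) K(θy − c) dy` by dominated convergence) — additivity/continuity of `f ↦ Ψ_f` as in the landed
`MirrorModularBoostsPlanarSpectralConeDensityHelpers` (`fieldVec_add`, `fieldVec_smul`, `norm_fieldVec_sq`). -/
theorem stub_sharpOnePointVectors :
    open Literature.MathematicalPhysics.QuantumLattice Literature.MathematicalPhysics.AQFT
      Literature.MathematicalPhysics.QuantumFieldTheory
      Summit.QuantumFields.YangMills.Theorems.NPointIsotropy.Negative in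
    ∀ (S₁ : SchwingerFamily E4) (h : OSReconstructionNoE1 S₁.toLabelled) (K : E4 → ℝ) (C η : ℝ),
      ContinuousOn K {x : E4 | x ≠ 0} → (∀ x : E4, x ≠ 0 → |K x| ≤ C * (1 + ‖x‖ ^ (η - 10))) →
      (∀ F : SchwartzMap (Fin 2 → E4) ℂ, IsOffDiagonal F →
        MeasureTheory.Integrable (fun x : Fin 2 → E4 => (K (x 0 - x 1) : ℂ) * F x) ∧
          S₁ 2 F = ∫ x : Fin 2 → E4, (K (x 0 - x 1) : ℂ) * F x) →
      ∃ Φ : E4 → h.Hilbert,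
        ContinuousOn Φ {c : E4 | 0 < c 0} ∧
        (∀ c : E4, 0 < c 0 → ‖Φ c‖ ^ 2 ≤ C * (1 + (2 * c 0) ^ (η - 10))) ∧
        (∀ c : E4, 0 < c 0 → ∀ t : ℝ, 0 ≤ t → ∀ a : E4, a 0 = 0 →
          Φ (c + t • EuclideanSpace.single 0 1 + a) = h.transfer t (h.translate a (Φ c))) ∧
        ∀ (f : SchwartzMap (Fin 1 → E4) ℂ) (hf : IsTimeOrdered f),
          HasCompactSupport (f : (Fin 1 → E4) → ℂ) →
          h.fieldVec 1 (fun _ => ()) f hf = ∫ c : E4, f (fun _ => c) • Φ c := by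
  sorry

/-- **Stub 4a-ii-β — THE DOUBLED ORBIT KERNEL IN DEGREE ONE FROM SHARP VECTORS AND THE OPERATOR CONE (model-blind;
difficulty M–L; PROVABLE NOW; registered at reshape 9).**  Let `h` be an `e₀`-reconstruction of `S₁` whose joint spectral
measures are carried by the closed planar cone `{p₀ ≥ |p₁|}` (the operator cone; the composition supplies it from the landed
proof of item 9664), and let `Φ` be sharp one-point vectors as in Stub 4a-ii-α (continuity on `{c⁰ > 0}`, the norm bound
`‖Φ_c‖² ≤ C (1 + (2c⁰)^(η−10))`, covariance, `Ψ_f = ∫ f Φ`).  Then the conclusion of the doubled-orbit-kernel statement holds in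
degree `n = 1` with a type depending on `η` only: for every compactly supported time-ordered one-point `F` there is `ε > 0`
with `R_θ F` time-ordered for real `|θ| < ε` (rotation margin, landed `RayPositivity.exists_isTimeOrdered_planeRot`) and a
function `K(η', η)` jointly holomorphic on the square of the strip `{|Re z| < ε}`, equal to `𝔖₂(Θ(R_{η'}F)* ⊗ R_η F)` at real
points and with `|K(θ̄, θ)| ≤ C' e^{2N|Im θ|}`.  Proof on offer: take the operator cone family `N` of the landed
`stub_operatorConeFamily` (file `…OperatorConeFamily`, with `OperatorConeFamily.family_add` — the semigroup law — and
`family_translate_comm`); for `θ = σ + iχ` and a point `c` with `(R_σ c)⁰ > 0` one has `(R_θ c)⁰ = cosh χ (R_σ c)⁰ − i sinh χ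
(R_σ c)¹`, `(R_θ c)¹ = cosh χ (R_σ c)¹ + i sinh χ (R_σ c)⁰`, so the slot `w(θ, c) = ((R_θ c)⁰ − t₀, (R_θ c)¹)` lies in the tube
`{|Im β| < Re ζ}` iff `t₀ < e^{-|χ|} (R_σ c)⁰`; put `V(θ) := ∫ F(c) • N(w(θ, c)) (U(c⊥) Φ_{t₀ e₀}) dc` with any admissible `t₀`
(independent of the choice by the semigroup law and the covariance of `Φ`, which also give `V(θ) = Ψ_{R_θ F} = ∫ (R_θF) Φ`
at real `θ`); then `K(η', η) := ⟪V(conj η'), V(η)⟫ = ∫∫ conj F(c') F(c) ⟪Φ_{t₀e₀}, U(c⊥ − c'⊥) N(w(η', c')ᵀ + w(η, c)) Φ_{t₀e₀}⟫`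
(`N(ζ, β)* = N(conj ζ, −conj β)` by uniqueness on the tube, `OperatorConeFamily.eq_of_eq_on_real`; `ᵀ` = that reflection) is
a parameter integral of matrix elements of `N` at points of the tube depending holomorphically on `(η', η)` — jointly
holomorphic — and on the conjugate diagonal `K(θ̄, θ) = ‖V θ‖² ≤ ‖F‖₁² ‖Φ_{t₀(θ)e₀}‖² ≤ C_F e^{(10−η)|Im θ|}` with
`t₀(θ) = e^{-|Im θ|} δ_F / 2` (`‖N‖ ≤ 1` on the tube): `N = (10 − η)/2 ⊔ 0`. -/
theorem stub_doubledOrbitKernelOne :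
    open Literature.MathematicalPhysics.QuantumLattice Literature.MathematicalPhysics.AQFT
      Literature.MathematicalPhysics.QuantumFieldTheory
      Summit.QuantumFields.YangMills.Theorems.NPointIsotropy.Negative in
    ∀ (S₁ : SchwingerFamily E4) (h : OSReconstructionNoE1 S₁.toLabelled),
      (∀ (ψ : h.Hilbert) (μ : MeasureTheory.Measure E4), h.IsJointSpectralMeasure ψ μ →
        μ {p : E4 | p 0 < |p 1|} = 0) →
      ∀ (Φ : E4 → h.Hilbert) (C η : ℝ),
        ContinuousOn Φ {c : E4 | 0 < c 0} →
        (∀ c : E4, 0 < c 0 → ‖Φ c‖ ^ 2 ≤ C * (1 + (2 * c 0) ^ (η - 10))) →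
        (∀ c : E4, 0 < c 0 → ∀ t : ℝ, 0 ≤ t → ∀ a : E4, a 0 = 0 →
          Φ (c + t • EuclideanSpace.single 0 1 + a) = h.transfer t (h.translate a (Φ c))) →
        (∀ (f : SchwartzMap (Fin 1 → E4) ℂ) (hf : IsTimeOrdered f),
          HasCompactSupport (f : (Fin 1 → E4) → ℂ) →
          h.fieldVec 1 (fun _ => ()) f hf = ∫ c : E4, f (fun _ => c) • Φ c) →
        ∃ N : ℝ, ∀ (F : SchwartzMap (Fin 1 → E4) ℂ), IsTimeOrdered F →
          HasCompactSupport (F : (Fin 1 → E4) → ℂ) →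
          ∃ ε : ℝ, 0 < ε ∧
            (∀ θ : ℝ, |θ| < ε → IsTimeOrdered (linActMulti (planeRot (0 : Fin 3) θ) F)) ∧
            ∃ (K : ℂ → ℂ → ℂ) (C' : ℝ),
              DifferentiableOn ℂ (Function.uncurry K) ({z : ℂ | |z.re| < ε} ×ˢ {z : ℂ | |z.re| < ε}) ∧
              (∀ θ : ℂ, |θ.re| < ε → ‖K (starRingEnd ℂ θ) θ‖ ≤ C' * Real.exp (2 * N * |θ.im|)) ∧
              ∀ θ θ' : ℝ, |θ| < ε → |θ'| < ε →
                ∀ H : SchwartzMap (Fin (1 + 1) → E4) ℂ,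
                  IsAppendTensorOf H (osAdjoint (linActMulti (planeRot (0 : Fin 3) θ') F))
                    (linActMulti (planeRot (0 : Fin 3) θ) F) →
                  K θ' θ = S₁ (1 + 1) H := by
  sorry

/-- **Stub 4a-ii-γ — THE DOUBLED ORBIT KERNEL IN DEGREES `n ≥ 2` (model-blind; difficulty XL; registered at reshape 9: the
reshape-6 statement `stub_doubledOrbitKernel` restricted to `n ≥ 2` and WEAKENED by the kernel triple of `S₁ 2` as an extra
hypothesis).**  For a one-species family with an `e₀`-reconstruction `h`, E0', E3, reflection positivity in the eight planar
frames, the planar cone, the operator cone of `h` and the kernel triple, and every degree `n ≥ 2`, there is a type `N` such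
that every compactly supported time-ordered `F` of degree `n` has a rotation margin `ε` and a doubled orbit kernel `K(η', η) =
𝔖_{2n}(Θ(R_{η'}F)* ⊗ R_η F)` jointly holomorphic on the square of the strip with `|K(θ̄, θ)| ≤ C e^{2N|Im θ|}`.  TRUTH = OS II
multi-slot continuation WITHOUT E1 along the complex-rotation orbits of doubled configurations in the planar tube (the `n − 1`
internal slots of each half move simultaneously): the sharp vectors of degree `1` and the one-slot cone family do not suffice;
the inductive envelope-of-holomorphy construction of OS II Ch. V with slot operators `N(ζ, β)` and Ch. VI temperedness give it.
Certified inhabitants: vacuum / c-number fields (`K` constant).  Recommended: a shared model-blind item for 9663 / 14999 / 11686. -/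
theorem stub_doubledOrbitKernelHigh :
    open Literature.MathematicalPhysics.QuantumLattice Literature.MathematicalPhysics.AQFT
      Literature.MathematicalPhysics.QuantumFieldTheory
      Summit.QuantumFields.YangMills.Theorems.CurvatureBoostCovariance.Negative
      Summit.QuantumFields.YangMills.Theorems.NPointIsotropy.Negative in
    ∀ (S₁ : SchwingerFamily E4) (h : OSReconstructionNoE1 S₁.toLabelled),
      S₁.toLabelled.HasLinearGrowth → S₁.toLabelled.IsSymmetric → EightFrameRP S₁ → PlanarCone S₁ →
      (∀ (ψ : h.Hilbert) (μ : MeasureTheory.Measure E4), h.IsJointSpectralMeasure ψ μ →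
        μ {p : E4 | p 0 < |p 1|} = 0) →
      (∃ (K : E4 → ℝ) (C η : ℝ), 0 < η ∧ ContinuousOn K {x : E4 | x ≠ 0} ∧
        (∀ x : E4, x ≠ 0 → |K x| ≤ C * (1 + ‖x‖ ^ (η - 10))) ∧
        ∀ F : SchwartzMap (Fin 2 → E4) ℂ, IsOffDiagonal F →
          MeasureTheory.Integrable (fun x : Fin 2 → E4 => (K (x 0 - x 1) : ℂ) * F x) ∧
            S₁ 2 F = ∫ x : Fin 2 → E4, (K (x 0 - x 1) : ℂ) * F x) →
      ∀ (n : ℕ), 2 ≤ n → ∃ N : ℝ, ∀ (F : SchwartzMap (Fin n → E4) ℂ), IsTimeOrdered F →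
        HasCompactSupport (F : (Fin n → E4) → ℂ) →
        ∃ ε : ℝ, 0 < ε ∧
          (∀ η : ℝ, |η| < ε → IsTimeOrdered (linActMulti (planeRot (0 : Fin 3) η) F)) ∧
          ∃ (K : ℂ → ℂ → ℂ) (C : ℝ),
            DifferentiableOn ℂ (Function.uncurry K) ({z : ℂ | |z.re| < ε} ×ˢ {z : ℂ | |z.re| < ε}) ∧
            (∀ θ : ℂ, |θ.re| < ε → ‖K (starRingEnd ℂ θ) θ‖ ≤ C * Real.exp (2 * N * |θ.im|)) ∧
            ∀ η η' : ℝ, |η| < ε → |η'| < ε →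
              ∀ H : SchwartzMap (Fin (n + n) → E4) ℂ,
                IsAppendTensorOf H (osAdjoint (linActMulti (planeRot (0 : Fin 3) η') F))
                  (linActMulti (planeRot (0 : Fin 3) η) F) →
                K η' η = S₁ (n + n) H := by
  sorry

/-- In degree `0` the diagonal action of any isometry is the identity (`Fin 0 → ℝ⁴` is a point). -/
theorem linActMulti_fin_zero (R : E4 ≃ₗᵢ[ℝ] E4) (F : 𝓢((Fin 0 → E4), ℂ)) : linActMulti R F = F := by
  ext x
  rw [linActMulti_apply]
  congr 1
  funext i
  exact Fin.elim0 i

/-- A tensor witness is determined by its factors. -/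
theorem appendTensor_witness_unique {n m : ℕ} {H H' : 𝓢((Fin (n + m) → E4), ℂ)} {A : 𝓢((Fin n → E4), ℂ)}
    {B : 𝓢((Fin m → E4), ℂ)} (hH : IsAppendTensorOf H A B) (hH' : IsAppendTensorOf H' A B) : H = H' := by
  ext x
  rw [hH x, hH' x]

/-- **Degree `0` of the doubled orbit kernel** (trivial: the rotation acts as the identity and the tensor witness is
unique, so the kernel is the constant `𝔖₀(ΘF* ⊗ F)`). -/
theorem doubledOrbitKernel_zero (S₁ : SchwingerFamily E4) :
    ∃ N : ℝ, ∀ (F : 𝓢((Fin 0 → E4), ℂ)), IsTimeOrdered F → HasCompactSupport (F : (Fin 0 → E4) → ℂ) →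
      ∃ ε : ℝ, 0 < ε ∧
        (∀ η : ℝ, |η| < ε → IsTimeOrdered (linActMulti (planeRot (0 : Fin 3) η) F)) ∧
        ∃ (K : ℂ → ℂ → ℂ) (C : ℝ),
          DifferentiableOn ℂ (Function.uncurry K) ({z : ℂ | |z.re| < ε} ×ˢ {z : ℂ | |z.re| < ε}) ∧
          (∀ θ : ℂ, |θ.re| < ε → ‖K (starRingEnd ℂ θ) θ‖ ≤ C * Real.exp (2 * N * |θ.im|)) ∧
          ∀ η η' : ℝ, |η| < ε → |η'| < ε →
            ∀ H : 𝓢((Fin (0 + 0) → E4), ℂ),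
              IsAppendTensorOf H (osAdjoint (linActMulti (planeRot (0 : Fin 3) η') F))
                (linActMulti (planeRot (0 : Fin 3) η) F) →
              K η' η = S₁ (0 + 0) H := by
  refine ⟨0, fun F hF _ => ⟨1, one_pos, fun η _ => by rwa [linActMulti_fin_zero], ?_⟩⟩
  obtain ⟨H₀, hH₀⟩ := exists_isAppendTensorOf (osAdjoint F) F
  refine ⟨fun _ _ => S₁ (0 + 0) H₀, ‖S₁ (0 + 0) H₀‖, differentiableOn_const _, fun θ _ => by simp, ?_⟩
  intro η η' _ _ H hH
  rw [linActMulti_fin_zero, linActMulti_fin_zero] at hH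
  show S₁ (0 + 0) H₀ = S₁ (0 + 0) H
  rw [appendTensor_witness_unique hH₀ hH]

/-- **The doubled orbit kernel for the GIVEN family, all degrees** (reshape 9 glue): degree `0` trivial, degree `1` from
Stubs 4a-ii-α/β, degrees `≥ 2` from Stub 4a-ii-γ. -/
theorem doubledOrbitKernel_local (S₁ : SchwingerFamily E4) (h : OSReconstructionNoE1 S₁.toLabelled)
    (hlg : S₁.toLabelled.HasLinearGrowth) (hsym : S₁.toLabelled.IsSymmetric) (h8 : EightFrameRP S₁)
    (hC : PlanarCone S₁)
    (hop : ∀ (ψ : h.Hilbert) (μ : Measure E4), h.IsJointSpectralMeasure ψ μ → μ {p : E4 | p 0 < |p 1|} = 0)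
    (hK : ∃ (K : E4 → ℝ) (C η : ℝ), 0 < η ∧ ContinuousOn K {x : E4 | x ≠ 0} ∧
      (∀ x : E4, x ≠ 0 → |K x| ≤ C * (1 + ‖x‖ ^ (η - 10))) ∧
      ∀ F : 𝓢((Fin 2 → E4), ℂ), IsOffDiagonal F →
        Integrable (fun x : Fin 2 → E4 => (K (x 0 - x 1) : ℂ) * F x) ∧
          S₁ 2 F = ∫ x : Fin 2 → E4, (K (x 0 - x 1) : ℂ) * F x) :
    ∀ (n : ℕ), ∃ N : ℝ, ∀ (F : 𝓢((Fin n → E4), ℂ)), IsTimeOrdered F →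
      HasCompactSupport (F : (Fin n → E4) → ℂ) →
      ∃ ε : ℝ, 0 < ε ∧
        (∀ η : ℝ, |η| < ε → IsTimeOrdered (linActMulti (planeRot (0 : Fin 3) η) F)) ∧
        ∃ (K : ℂ → ℂ → ℂ) (C : ℝ),
          DifferentiableOn ℂ (Function.uncurry K) ({z : ℂ | |z.re| < ε} ×ˢ {z : ℂ | |z.re| < ε}) ∧
          (∀ θ : ℂ, |θ.re| < ε → ‖K (starRingEnd ℂ θ) θ‖ ≤ C * Real.exp (2 * N * |θ.im|)) ∧
          ∀ η η' : ℝ, |η| < ε → |η'| < ε →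
            ∀ H : 𝓢((Fin (n + n) → E4), ℂ),
              IsAppendTensorOf H (osAdjoint (linActMulti (planeRot (0 : Fin 3) η') F))
                (linActMulti (planeRot (0 : Fin 3) η) F) →
              K η' η = S₁ (n + n) H := by
  intro n
  match n with
  | 0 => exact doubledOrbitKernel_zero S₁
  | 1 =>
    obtain ⟨Kf, C, η, -, hKc, hKb, hKrep⟩ := hK
    obtain ⟨Φ, hΦc, hΦb, hΦcov, hΦint⟩ := stub_sharpOnePointVectors S₁ h Kf C η hKc hKb hKrep
    exact stub_doubledOrbitKernelOne S₁ h hop Φ C η hΦc hΦb hΦcov hΦint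
  | k + 2 => exact stub_doubledOrbitKernelHigh S₁ h hlg hsym h8 hC hop hK (k + 2) (by omega)

/-- **Stub 4a-iii — THE OPERATOR CONE FAMILY `e^{-ζH + iβP₁}` (groundwork R1 for Stub 4a-ii; abstract: any labelled
family with E2 + translations whose `e₀`-reconstruction has the operator cone; pure bounded functional analysis; difficulty M;
registered by the continuation lead c1 at reshape 7, 2026-08-16, PROVED by the lead and LANDED as
`Theorems/MirrorModularBoostsCurvatureBoostCovarianceOperatorConeFamily.lean`, p98376, so that the attacker of Stub 4a-ii
imports it — it is not consumed by the composition).**  If every joint spectral measure of `(H, P⃗)` is carried by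
the closed planar cone `{p₀ ≥ |p₁|}`, then the matrix elements `⟪ψ, e^{-tH} U(b e₁) ψ'⟫` are those of ONE family of bounded
operators `W(ζ, β)`, `‖W‖ ≤ 1`, indexed by the open tube `D = {(ζ, β) : |Im β| < Re ζ}`, with every matrix element
`w ↦ ⟪ψ, W(w) ψ'⟫` holomorphic on `D` and `W(t, b) = e^{-tH} U(b e₁)` at the real points `t > 0`.  Proof on offer: the landed
matrix-element family `PositivityDiscToOperatorCone.Contraction.contractionFamily` (`Φ_{ψ,ψ'}` holomorphic on `D`, `= ⟪ψ,
e^{-tH}U(be₁)ψ'⟫` at real points, `|Φ| ≤ ‖ψ‖‖ψ'‖`) is sesquilinear in `(ψ, ψ')` by UNIQUENESS on `D` (two one-variable identity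
theorems: in `ζ` on the right half-plane at real `β`, then in `β` on the strip `{|Im β| < Re ζ}`), hence a bounded sesquilinear
form for each `w ∈ D`; Riesz (`InnerProductSpace.toDual`) turns it into `W(w)` with `‖W(w)‖ ≤ 1`; at real points
`⟪ψ, W ψ'⟫ = ⟪ψ, e^{-tH}U(be₁)ψ'⟫` for all `ψ` identifies the vectors.  (Strong/norm holomorphy and the semigroup law
`W(w + w') = W(w) W(w')` follow by the same uniqueness and are left to the consumer.) -/
theorem stub_operatorConeFamily :
    open Literature.MathematicalPhysics.QuantumLattice Literature.MathematicalPhysics.AQFT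
      Literature.MathematicalPhysics.QuantumFieldTheory
      Summit.QuantumFields.YangMills.Theorems.NPointIsotropy.Negative in
    ∀ (ι : Type) (T : LabelledSchwingerFamily ι E4) (h : OSReconstructionNoE1 T),
      (∀ (ψ : h.Hilbert) (μ : MeasureTheory.Measure E4), h.IsJointSpectralMeasure ψ μ →
        μ {p : E4 | p 0 < |p 1|} = 0) →
      ∃ W : ℂ × ℂ → (h.Hilbert →L[ℂ] h.Hilbert),
        (∀ ψ ψ' : h.Hilbert,
          DifferentiableOn ℂ (fun w : ℂ × ℂ => ⟪ψ, W w ψ'⟫_ℂ) {w : ℂ × ℂ | |w.2.im| < w.1.re}) ∧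
        (∀ w : ℂ × ℂ, |w.2.im| < w.1.re → ‖W w‖ ≤ 1) ∧
        ∀ (t b : ℝ), 0 < t → ∀ ψ' : h.Hilbert,
          W ((t : ℂ), (b : ℂ)) ψ' = h.transfer t (h.translate (b • EuclideanSpace.single 1 1) ψ') :=
  Summit.QuantumFields.YangMills.Theorems.CurvatureBoostCovariance.BoostsInheritMirrors.stub_operatorConeFamily

/-- **Stub 4a — UNIFORM PLANAR BOOST VECTORS for the GIVEN family (reshape 9; reshape 6's universal form retired).**  For
a one-species family with an `e₀`-reconstruction `h`, E0', E3, the eight frames, the planar cone and the KERNEL TRIPLE, and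
every degree `n`, there is a type `N` such that every compactly supported time-ordered `F` of degree `n` has `ε > 0`, `C` and
`V : ℂ → ℋ` holomorphic on the strip `{|Re θ| < ε}` with `‖V θ‖ ≤ C e^{N|Im θ|}` and `V θ = Ψ_{R_θ F}` for real `|θ| < ε`.
PROVED from Stub 4a-i (`stub_gramVecOnStrip`, landed) and the local doubled orbit kernel (`doubledOrbitKernel_local`): the
vectors `Φ η := Ψ_{R_η F}` have the doubled orbit kernel as Gram kernel; the operator cone of `h` is supplied by the landed
proof of item 9664 (`planarConeSupport_of_parts` with its four landed stubs). -/
theorem uniformPlanarBoostVectors_local (S₁ : SchwingerFamily E4) (h : OSReconstructionNoE1 S₁.toLabelled)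
    (hlg : S₁.toLabelled.HasLinearGrowth) (hsym : S₁.toLabelled.IsSymmetric) (h8 : EightFrameRP S₁)
    (hC : PlanarCone S₁)
    (hK : ∃ (K : E4 → ℝ) (C η : ℝ), 0 < η ∧ ContinuousOn K {x : E4 | x ≠ 0} ∧
      (∀ x : E4, x ≠ 0 → |K x| ≤ C * (1 + ‖x‖ ^ (η - 10))) ∧
      ∀ F : 𝓢((Fin 2 → E4), ℂ), IsOffDiagonal F →
        Integrable (fun x : Fin 2 → E4 => (K (x 0 - x 1) : ℂ) * F x) ∧
          S₁ 2 F = ∫ x : Fin 2 → E4, (K (x 0 - x 1) : ℂ) * F x) :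
    ∀ (n : ℕ), ∃ N : ℝ, ∀ (F : 𝓢((Fin n → E4), ℂ)), IsTimeOrdered F →
      HasCompactSupport (F : (Fin n → E4) → ℂ) →
      ∃ ε : ℝ, 0 < ε ∧ ∃ (V : ℂ → h.Hilbert) (C : ℝ),
        DifferentiableOn ℂ V {θ : ℂ | |θ.re| < ε} ∧
        (∀ θ : ℂ, |θ.re| < ε → ‖V θ‖ ≤ C * Real.exp (N * |θ.im|)) ∧
        ∀ θ : ℝ, |θ| < ε → ∀ hθ : IsTimeOrdered (linActMulti (planeRot (0 : Fin 3) θ) F),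
          V θ = h.fieldVec n (fun _ => ()) (linActMulti (planeRot (0 : Fin 3) θ) F) hθ := by
  classical
  intro n
  have htr : Translations S₁ := fun N a F hF => h.translationInvariant N (fun _ => ()) a F hF
  have hop : ∀ (ψ : h.Hilbert) (μ : MeasureTheory.Measure E4), h.IsJointSpectralMeasure ψ μ →
      μ {p : E4 | p 0 < |p 1|} = 0 :=
    Summit.QuantumFields.YangMills.Cruxes.PlanarSpectralCone.PositivityDiscToOperatorCone.planarConeSupport_of_parts
      Summit.QuantumFields.YangMills.Cruxes.PlanarSpectralCone.PositivityDiscToOperatorCone.stub_discSections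
      Summit.QuantumFields.YangMills.Cruxes.PlanarSpectralCone.PositivityDiscToOperatorCone.stub_cone_of_discSections
      Summit.QuantumFields.YangMills.Cruxes.PlanarSpectralCone.PositivityDiscToOperatorCone.stub_density
      Summit.QuantumFields.YangMills.Cruxes.PlanarSpectralCone.PositivityDiscToOperatorCone.stub_linearity
      S₁ hlg hsym htr h8 h
  obtain ⟨N, hN⟩ := doubledOrbitKernel_local S₁ h hlg hsym h8 hC hop hK n
  refine ⟨N, fun F hF hFc => ?_⟩
  obtain ⟨ε, hε, hto, K, C, hKd, hKg, hKr⟩ := hN F hF hFc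
  -- the field vectors of the rotated test functions at the real points of the strip
  let Φ : ℝ → h.Hilbert := fun η =>
    if hη : |η| < ε then h.fieldVec n (fun _ => ()) (linActMulti (planeRot (0 : Fin 3) η) F) (hto η hη) else 0
  have hGram : ∀ η η' : ℝ, |η| < ε → |η'| < ε → ⟪Φ η', Φ η⟫_ℂ = K η' η := by
    intro η η' hη hη'
    simp only [Φ, dif_pos hη, dif_pos hη']
    obtain ⟨H, hH⟩ := exists_isAppendTensorOf (osAdjoint (linActMulti (planeRot (0 : Fin 3) η') F))
      (linActMulti (planeRot (0 : Fin 3) η) F)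
    rw [h.inner_fieldVec_fieldVec _ _ (hto η' hη') (hto η hη) hH, hKr η η' hη hη' H hH]
    rfl
  obtain ⟨Ψ, hΨd, hΨr, hΨg⟩ := stub_gramVecOnStrip h.Hilbert ε hε Φ K hKd hGram
  refine ⟨ε, hε, Ψ, Real.sqrt C, hΨd, fun θ hθ => ?_, fun θ hθ hθ' => ?_⟩
  · -- ‖Ψ θ‖² = Re K(θ̄, θ) ≤ C e^{2N|Im θ|}
    have hsq : ‖Ψ θ‖ ^ 2 ≤ C * Real.exp (2 * N * |θ.im|) := by
      have h1 : (‖Ψ θ‖ ^ 2 : ℝ) = (⟪Ψ θ, Ψ θ⟫_ℂ).re := by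
        rw [← inner_self_eq_norm_sq (𝕜 := ℂ) (Ψ θ)]; rfl
      rw [h1, hΨg θ θ hθ hθ]
      exact (Complex.re_le_norm _).trans (hKg θ hθ)
    have hC : 0 ≤ C := by
      by_contra hC
      have : C * Real.exp (2 * N * |θ.im|) < 0 := mul_neg_of_neg_of_pos (lt_of_not_ge hC) (Real.exp_pos _)
      exact absurd (hsq.trans_lt this) (not_lt.2 (sq_nonneg _))
    have hrhs : C * Real.exp (2 * N * |θ.im|) = (Real.sqrt C * Real.exp (N * |θ.im|)) ^ 2 := by
      rw [mul_pow, Real.sq_sqrt hC, sq (Real.exp _), ← Real.exp_add]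
      congr 1; ring_nf
    rw [hrhs] at hsq
    exact (pow_le_pow_iff_left₀ (norm_nonneg _) (by positivity) two_ne_zero).1 hsq
  · simp only [hΨr θ hθ, Φ, dif_pos hθ]

/-- The non-uniform form of the local boost vectors (forget the uniformity of the type; the shape consumed by the landed
`stub_rayPositivityLocal`). -/
theorem boostVectors_of_uniform_local {S' : SchwingerFamily E4} {h' : OSReconstructionNoE1 S'.toLabelled}
    (hu : ∀ (n : ℕ), ∃ N : ℝ, ∀ (F : 𝓢((Fin n → E4), ℂ)), IsTimeOrdered F →
      HasCompactSupport (F : (Fin n → E4) → ℂ) →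
      ∃ ε : ℝ, 0 < ε ∧ ∃ (V : ℂ → h'.Hilbert) (C : ℝ),
        DifferentiableOn ℂ V {θ : ℂ | |θ.re| < ε} ∧
        (∀ θ : ℂ, |θ.re| < ε → ‖V θ‖ ≤ C * Real.exp (N * |θ.im|)) ∧
        ∀ θ : ℝ, |θ| < ε → ∀ hθ : IsTimeOrdered (linActMulti (planeRot (0 : Fin 3) θ) F),
          V θ = h'.fieldVec n (fun _ => ()) (linActMulti (planeRot (0 : Fin 3) θ) F) hθ) :
    ∀ (n : ℕ) (F : 𝓢((Fin n → E4), ℂ)), IsTimeOrdered F → HasCompactSupport (F : (Fin n → E4) → ℂ) →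
      ∃ ε : ℝ, 0 < ε ∧ ∃ (V : ℂ → h'.Hilbert) (C N : ℝ),
        DifferentiableOn ℂ V {θ : ℂ | |θ.re| < ε} ∧
        (∀ θ : ℂ, |θ.re| < ε → ‖V θ‖ ≤ C * Real.exp (N * |θ.im|)) ∧
        ∀ θ : ℝ, |θ| < ε → ∀ hθ : IsTimeOrdered (linActMulti (planeRot (0 : Fin 3) θ) F),
          V θ = h'.fieldVec n (fun _ => ()) (linActMulti (planeRot (0 : Fin 3) θ) F) hθ := by
  intro n F hF hFc
  obtain ⟨N, hN⟩ := hu n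
  obtain ⟨ε, hε, V, C, hd, hg, hv⟩ := hN F hF hFc
  exact ⟨ε, hε, V, C, N, hd, hg, hv⟩

/-- **The kernel triple is transported by isometries**: if `S₁ 2 = ∫ K(x₀ − x₁)·` on `⁰𝒮` then the pull-back family
`S₁ ∘ (R ·)` has the kernel `K ∘ R` on `⁰𝒮`, with the same continuity and UV bound (change of variables along the
measure-preserving diagonal action of `R`). -/
theorem kernelTriple_pullBack {S₁ : SchwingerFamily E4} (R : E4 ≃ₗᵢ[ℝ] E4)
    (hK : ∃ (K : E4 → ℝ) (C η : ℝ), 0 < η ∧ ContinuousOn K {x : E4 | x ≠ 0} ∧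
      (∀ x : E4, x ≠ 0 → |K x| ≤ C * (1 + ‖x‖ ^ (η - 10))) ∧
      ∀ F : 𝓢((Fin 2 → E4), ℂ), IsOffDiagonal F →
        Integrable (fun x : Fin 2 → E4 => (K (x 0 - x 1) : ℂ) * F x) ∧
          S₁ 2 F = ∫ x : Fin 2 → E4, (K (x 0 - x 1) : ℂ) * F x) :
    ∃ (K : E4 → ℝ) (C η : ℝ), 0 < η ∧ ContinuousOn K {x : E4 | x ≠ 0} ∧
      (∀ x : E4, x ≠ 0 → |K x| ≤ C * (1 + ‖x‖ ^ (η - 10))) ∧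
      ∀ F : 𝓢((Fin 2 → E4), ℂ), IsOffDiagonal F →
        Integrable (fun x : Fin 2 → E4 => (K (x 0 - x 1) : ℂ) * F x) ∧
          (fun n => (S₁ n).comp (linActMulti R)) 2 F = ∫ x : Fin 2 → E4, (K (x 0 - x 1) : ℂ) * F x := by
  obtain ⟨K, C, η, hη, hKc, hKb, hKrep⟩ := hK
  have hR0 : ∀ x : E4, x ≠ 0 → R x ≠ 0 := fun x hx h0 => hx (by simpa using congrArg R.symm h0)
  refine ⟨fun x => K (R x), C, η, hη, ?_, fun x hx => ?_, fun F hF => ?_⟩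
  · exact hKc.comp R.continuous.continuousOn fun x hx => hR0 x hx
  · simpa [R.norm_map] using hKb (R x) (hR0 x hx)
  · have hoff : IsOffDiagonal (linActMulti R F) :=
      Summit.QuantumFields.YangMills.Theorems.CurvatureBoostCovariance.Negative.isOffDiagonal_linActMulti hF R
    obtain ⟨hint, hrep⟩ := hKrep _ hoff
    -- the measure-preserving diagonal action `y ↦ (R yᵢ)ᵢ`
    have hmp : MeasurePreserving (fun (y : Fin 2 → E4) (i : Fin 2) => R (y i)) :=
      volume_preserving_pi fun _ => R.measurePreserving
    have hme : MeasurableEmbedding (fun (y : Fin 2 → E4) (i : Fin 2) => R (y i)) :=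
      (MeasurableEquiv.piCongrRight fun _ : Fin 2 => R.toHomeomorph.toMeasurableEquiv).measurableEmbedding
    have hcomp : (fun y : Fin 2 → E4 => (K (R (y 0 - y 1)) : ℂ) * F y) =
        (fun x : Fin 2 → E4 => (K (x 0 - x 1) : ℂ) * linActMulti R F x) ∘
          (fun (y : Fin 2 → E4) (i : Fin 2) => R (y i)) := by
      funext y
      simp only [Function.comp_apply, linActMulti_apply, map_sub, LinearIsometryEquiv.symm_apply_apply]
    refine ⟨?_, ?_⟩
    · rw [hcomp]
      exact (hmp.integrable_comp_emb hme).2 hint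
    · show S₁ 2 (linActMulti R F) = _
      rw [hrep, hcomp]
      exact (hmp.integral_comp hme _).symm

/-- **Stub 4b — the CORE of Stub 4 (pure Hilbert-space complex analysis; model-blind; difficulty M; PROVED by the wave-1
worker, registered at reshape 2 so that its file can land).**  If two vector functions `VF, VG : ℂ → H` are holomorphic on
a vertical strip `{|Re θ| < ε}` and the four sesquilinear pairings `θ ↦ ⟪V•(-θ̄)… ⟫` restricted to the real segment
`|θ| < ε` are trigonometric polynomials in `e^{4iθ}` with coefficients `p, q, q', r`, then for every `s > 0` the 2×2
Laurent pencil at `s` is the Gram form of `VF(iχ), VG(iχ)` (`s = e^{-4χ}`; identity theorem on the strip), hence positive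
semidefinite.  This is the `s > 0` half of Stub 4 for an abstract family; Stub 4 applies it to `S₁` and to its 45° pull-back. -/
theorem stub_rayPositivityCore :
    ∀ (H : Type) [NormedAddCommGroup H] [InnerProductSpace ℂ H] (ε : ℝ), 0 < ε →
      ∀ (VF VG : ℂ → H), DifferentiableOn ℂ VF {θ : ℂ | |θ.re| < ε} →
        DifferentiableOn ℂ VG {θ : ℂ | |θ.re| < ε} →
      ∀ (Kp Kq Kq' Kr : ℕ) (p q q' r : ℤ → ℂ),
        (∀ θ : ℝ, |θ| < ε → ⟪VF (-(θ : ℂ)), VF θ⟫_ℂ =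
          ∑ k ∈ Finset.Icc (-(Kp : ℤ)) Kp, p k * Complex.exp (4 * (k : ℂ) * (θ : ℂ) * Complex.I)) →
        (∀ θ : ℝ, |θ| < ε → ⟪VF (-(θ : ℂ)), VG θ⟫_ℂ =
          ∑ k ∈ Finset.Icc (-(Kq : ℤ)) Kq, q k * Complex.exp (4 * (k : ℂ) * (θ : ℂ) * Complex.I)) →
        (∀ θ : ℝ, |θ| < ε → ⟪VG (-(θ : ℂ)), VF θ⟫_ℂ =
          ∑ k ∈ Finset.Icc (-(Kq' : ℤ)) Kq', q' k * Complex.exp (4 * (k : ℂ) * (θ : ℂ) * Complex.I)) →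
        (∀ θ : ℝ, |θ| < ε → ⟪VG (-(θ : ℂ)), VG θ⟫_ℂ =
          ∑ k ∈ Finset.Icc (-(Kr : ℤ)) Kr, r k * Complex.exp (4 * (k : ℂ) * (θ : ℂ) * Complex.I)) →
        ∀ s : ℝ, 0 < s → ∀ v w : ℂ,
          (fun z : ℂ => 0 ≤ z.re ∧ z.im = 0)
            ((∑ k ∈ Finset.Icc (-(Kp : ℤ)) Kp, starRingEnd ℂ v * v * (p k * (s : ℂ) ^ k)) +
            (∑ k ∈ Finset.Icc (-(Kq : ℤ)) Kq, starRingEnd ℂ v * w * (q k * (s : ℂ) ^ k)) +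
            (∑ k ∈ Finset.Icc (-(Kq' : ℤ)) Kq', starRingEnd ℂ w * v * (q' k * (s : ℂ) ^ k)) +
            (∑ k ∈ Finset.Icc (-(Kr : ℤ)) Kr, starRingEnd ℂ w * w * (r k * (s : ℂ) ^ k))) :=
  Summit.QuantumFields.YangMills.Theorems.CurvatureBoostCovariance.BoostsInheritMirrors.stub_rayPositivityCore

/-- **Stub 4 — BOOSTS INHERIT THE MIRRORS: ray positivity of the doubled pencils (THE LEVER (i); model-blind;
difficulty L–XL; RESHAPED by the lead 2026-08-16: the analytic input Stub 4a is the explicit first hypothesis, and with it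
the stub is PROVED — wave-1 worker's reduction, landing in two files via Stub 4b).**  For a one-species family with the OS package, translations, E2 in the eight planar frames, the
planar cone of `S₁` AND the planar-cone theorem for eight-frame families (stub 2, for the 45° pull-backs), for
compactly supported `e₀`-time-ordered `F` (degree `n`) and `G` (degree `m`) with witnesses of the four doubled blocks
`ΘF*⊗F, ΘF*⊗G, ΘG*⊗F, ΘG*⊗G` whose orbit functions are trigonometric polynomials with coefficients `p, q, q', r`:
for every real `s ≠ 0` the 2×2 pencil `[[P(s), Q(s)], [Q'(s), R(s)]]` is positive semidefinite
(`v̄v P(s) + v̄w Q(s) + w̄v Q'(s) + w̄w R(s) ≥ 0`, real, for all `v, w ∈ ℂ`).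
Mechanism (card (i), re-derived by all three triagers): `s = e^{-4χ} > 0` is the entire pencil at the angle `iχ`;
for `|θ| < ε` (margin from the compact supports in the open ordered chambers) and all real `χ` the configuration
`R_{θ+iχ}·supp H` lies in the `e₀`-planar tube, where the multi-slot continuation of `𝔖_{n+m}` is holomorphic and,
at `θ = 0`, equals the Gram form `⟨Ψ^χ_F, Ψ^χ_G⟩` of `Ψ^χ_F := ∫F(x) ∏_j e^{-Δτ_j H_χ + iΔσ_j P_χ + iΔx⊥·P⊥} φ Ω`
(`-τH_χ + iσP_χ = -ζH + iβP₁` with `(ζ,β) = R_{iχ}(τ,σ)`; `ΘR_{iχ} = R_{-iχ}Θ` matches the bra; `H_χ ≥ e^{-|χ|}H ≥ 0`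
and `[H_χ, P_χ] = 0` by the cone, so the products are contractions for every real `χ`); identity theorem on the
strip `(-ε,ε) × iℝ` identifies it with the trig polynomial; Gram matrices are PSD.  `s = -e^{-4χ} < 0` is the angle
`π/4 + iχ`: `𝔖(R_{π/4}R_{θ'}·H)` is the orbit function of `H` under the pull-back `T = 𝔖 ∘ (R_{π/4}·)`, which is
`e₀`-RP (`EightFrameRP` at the frame `R_{π/4}`, time axis `(e₀ - e₁)/√2`) and has the `e₀`-cone by stub 2 (its E0',
E3, translations and eight frames are transported from `S₁`), so the same Gram argument applies to `T`.
No genericity and no gluing across frames is needed here (only the strip at `θ = 0`, resp. `θ = π/4`). -/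
theorem stub_rayPositivity :
    open Literature.MathematicalPhysics.QuantumLattice Literature.MathematicalPhysics.AQFT
      Literature.MathematicalPhysics.QuantumFieldTheory
      Summit.QuantumFields.YangMills.Theorems.CurvatureBoostCovariance.Negative
      Summit.QuantumFields.YangMills.Theorems.NPointIsotropy.Negative in
    (∀ (S₁ : SchwingerFamily E4) (h : OSReconstructionNoE1 S₁.toLabelled),
      S₁.toLabelled.HasLinearGrowth → S₁.toLabelled.IsSymmetric → EightFrameRP S₁ → PlanarCone S₁ →
      ∀ (n : ℕ) (F : SchwartzMap (Fin n → E4) ℂ), IsTimeOrdered F →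
        HasCompactSupport (F : (Fin n → E4) → ℂ) →
        ∃ ε : ℝ, 0 < ε ∧ ∃ (V : ℂ → h.Hilbert) (C N : ℝ),
          DifferentiableOn ℂ V {θ : ℂ | |θ.re| < ε} ∧
          (∀ θ : ℂ, |θ.re| < ε → ‖V θ‖ ≤ C * Real.exp (N * |θ.im|)) ∧
          ∀ θ : ℝ, |θ| < ε → ∀ hθ : IsTimeOrdered (linActMulti (planeRot (0 : Fin 3) θ) F),
            V θ = h.fieldVec n (fun _ => ()) (linActMulti (planeRot (0 : Fin 3) θ) F) hθ) →
    ∀ (S₁ : SchwingerFamily E4), OSPackage S₁ → Translations S₁ → EightFrameRP S₁ → PlanarCone S₁ →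
      Summit.QuantumFields.YangMills.Theses.MirrorModularBoosts.PlanarSpectralCone →
      ∀ (n m : ℕ) (F : SchwartzMap (Fin n → E4) ℂ) (G : SchwartzMap (Fin m → E4) ℂ),
        IsTimeOrdered F → IsTimeOrdered G →
        HasCompactSupport (F : (Fin n → E4) → ℂ) → HasCompactSupport (G : (Fin m → E4) → ℂ) →
        ∀ (HFF : SchwartzMap (Fin (n + n) → E4) ℂ) (HFG : SchwartzMap (Fin (n + m) → E4) ℂ)
          (HGF : SchwartzMap (Fin (m + n) → E4) ℂ) (HGG : SchwartzMap (Fin (m + m) → E4) ℂ),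
          IsAppendTensorOf HFF (osAdjoint F) F → IsAppendTensorOf HFG (osAdjoint F) G →
          IsAppendTensorOf HGF (osAdjoint G) F → IsAppendTensorOf HGG (osAdjoint G) G →
        ∀ (Kp Kq Kq' Kr : ℕ) (p q q' r : ℤ → ℂ),
          (∀ θ : ℝ, S₁ (n + n) (linActMulti (planeRot (0 : Fin 3) θ) HFF) =
            ∑ k ∈ Finset.Icc (-(Kp : ℤ)) Kp, p k * Complex.exp (4 * (k : ℂ) * (θ : ℂ) * Complex.I)) →
          (∀ θ : ℝ, S₁ (n + m) (linActMulti (planeRot (0 : Fin 3) θ) HFG) =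
            ∑ k ∈ Finset.Icc (-(Kq : ℤ)) Kq, q k * Complex.exp (4 * (k : ℂ) * (θ : ℂ) * Complex.I)) →
          (∀ θ : ℝ, S₁ (m + n) (linActMulti (planeRot (0 : Fin 3) θ) HGF) =
            ∑ k ∈ Finset.Icc (-(Kq' : ℤ)) Kq', q' k * Complex.exp (4 * (k : ℂ) * (θ : ℂ) * Complex.I)) →
          (∀ θ : ℝ, S₁ (m + m) (linActMulti (planeRot (0 : Fin 3) θ) HGG) =
            ∑ k ∈ Finset.Icc (-(Kr : ℤ)) Kr, r k * Complex.exp (4 * (k : ℂ) * (θ : ℂ) * Complex.I)) →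
        ∀ s : ℝ, s ≠ 0 → ∀ v w : ℂ,
          (fun z : ℂ => 0 ≤ z.re ∧ z.im = 0)
            ((∑ k ∈ Finset.Icc (-(Kp : ℤ)) Kp, starRingEnd ℂ v * v * (p k * (s : ℂ) ^ k)) +
            (∑ k ∈ Finset.Icc (-(Kq : ℤ)) Kq, starRingEnd ℂ v * w * (q k * (s : ℂ) ^ k)) +
            (∑ k ∈ Finset.Icc (-(Kq' : ℤ)) Kq', starRingEnd ℂ w * v * (q' k * (s : ℂ) ^ k)) +
            (∑ k ∈ Finset.Icc (-(Kr : ℤ)) Kr, starRingEnd ℂ w * w * (r k * (s : ℂ) ^ k))) :=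
  Summit.QuantumFields.YangMills.Theorems.CurvatureBoostCovariance.BoostsInheritMirrors.stub_rayPositivity

/-- **Stub 5₀ — the two-point UV datum BY NAME: `PencilRigidity.CurvatureKernelBound` (item stmt-QuantumFields-11687, crux of
route PencilRigidity with its own line lead; registered here at reshape 4, 2026-08-16).**  For every compact simple `G` and every
`(r, sch, S₁)` with the curvature package: `S₁ 2|⁰𝒮 = ∫ K(x₀ - x₁)·` with `K` real, continuous off `0`,
`|K x| ≤ C (1 + ‖x‖^(η-10))`, `η > 0` ("tr F² has dimension < 5").  USES THE TIE.  Level 1 of Stub 5 consumes it. -/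
theorem stub_curvatureKernelBound :
    Summit.QuantumFields.YangMills.Theses.PencilRigidity.CurvatureKernelBound := by
  sorry

/-- **Stub 5₁ — two-point rigidity BY NAME: `PencilRigidity.ShellRigidity` (item stmt-QuantumFields-11685, crux of route
PencilRigidity; registered here at reshape 4; DISCHARGED 2026-08-16: the item is closed `proved` by
`TransverseSmearingPlanarThreshold.ShellRigidity_proof`).**  A continuous-off-0 kernel below `|x|⁻¹⁰`, `W(B₄)`-invariant and
pointwise OS-positive across `x₀ = 0` and `x₀ = x₁`, is radial.  Together with the LANDED `PencilRigidity.KernelTransfer`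
(stmt-11688, `Theorems.KernelTransfer.kernelTransfer_proof`) and Stub 5₀ it makes the two-point kernel of `S₁` radial, hence
`S₁ 2` invariant on `⁰𝒮` under every isometry (`NPointIsotropy.Negative.radialKernel_invariant_two`), which is level 1 of Stub 5.
(A sufficient, possibly stronger-than-needed route: ShellRigidity does not use the cone; if 11685 dies, level 1 must come from
the cone + Stub 5₀ directly — TRIAGE r1-1 App. B.) -/
theorem stub_shellRigidity :
    Summit.QuantumFields.YangMills.Theses.PencilRigidity.ShellRigidity :=
  Summit.QuantumFields.YangMills.Cruxes.ShellRigidity.TransverseSmearingPlanarThreshold.ShellRigidity_proof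

/-- **Stub 5a — LEVEL GROWTH AT LEVELS `a ≤ 1` (difficulty M given Stubs 5₀, 5₁; PROVABLE NOW; split off by the lead at reshape
4).**  At level `a = 1` (`F` one-point, `H = ΘF* ⊗ F` two-point, the induction hypothesis vacuous) the diagonal doubled pencil
has no layer `|k| ≥ 2` — indeed no layer `k ≠ 0`: Stub 5₀ gives the kernel `K` of `S₁ 2` with its UV bound, the landed
KernelTransfer gives `W(B₄)`-invariance and axis/diagonal pointwise OS-positivity of `K` from E3 + Hypercubic + the eight frames,
Stub 5₁ makes `K` radial, `radialKernel_invariant_two` makes `S₁ 2` invariant on `⁰𝒮` under the rotations `planeRot 0 θ`, so the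
orbit function of the (off-diagonal) `H` is CONSTANT and the coefficients `p_k`, `k ≠ 0`, of its trigonometric representation
vanish (uniqueness of trigonometric coefficients).  Level `a = 0` is trivial (`linActMulti` acts as the identity in degree 0).
The statement keeps the shape of Stub 5 (same induction hypothesis, unused here) restricted to `a ≤ 1`, with the two
PencilRigidity items as explicit leading hypotheses BY NAME. -/
theorem stub_levelGrowthLow :
    open Literature.MathematicalPhysics.QuantumLattice Literature.MathematicalPhysics.AQFT
      Literature.MathematicalPhysics.QuantumFieldTheory
      Summit.QuantumFields.YangMills.Theorems.CurvatureBoostCovariance.Negative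
      Summit.QuantumFields.YangMills.Theorems.NPointIsotropy.Negative in
    Summit.QuantumFields.YangMills.Theses.PencilRigidity.CurvatureKernelBound →
    Summit.QuantumFields.YangMills.Theses.PencilRigidity.ShellRigidity →
    ∀ (G : Type) [Group G] [TopologicalSpace G] [IsTopologicalGroup G] [CompactSpace G]
      [MeasurableSpace G] [BorelSpace G], IsCompactSimpleLieGroup G →
      ∀ (r : LatticeRep G) (sch : SpeciesScheme (YMSpecies G)) (S₁ : SchwingerFamily E4),
        W1 r sch S₁ → EightFrameRP S₁ → PlanarCone S₁ →
        ∀ a : ℕ, a ≤ 1 →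
          (∀ N : ℕ, N + 2 ≤ 2 * a → ∀ R : E4 ≃ₗᵢ[ℝ] E4,
            LinearMap.det (R.toLinearEquiv : E4 →ₗ[ℝ] E4) = 1 →
            R (EuclideanSpace.single 2 1) = EuclideanSpace.single 2 1 →
            R (EuclideanSpace.single 3 1) = EuclideanSpace.single 3 1 →
            ∀ F : SchwartzMap (Fin N → E4) ℂ, IsOffDiagonal F → S₁ N (linActMulti R F) = S₁ N F) →
          ∀ (F : SchwartzMap (Fin a → E4) ℂ), IsTimeOrdered F → HasCompactSupport (F : (Fin a → E4) → ℂ) →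
          ∀ H : SchwartzMap (Fin (a + a) → E4) ℂ, IsAppendTensorOf H (osAdjoint F) F →
          ∀ (K : ℕ) (p : ℤ → ℂ),
            (∀ θ : ℝ, S₁ (a + a) (linActMulti (planeRot (0 : Fin 3) θ) H) =
              ∑ k ∈ Finset.Icc (-(K : ℤ)) K, p k * Complex.exp (4 * (k : ℂ) * (θ : ℂ) * Complex.I)) →
            ∀ k ∈ Finset.Icc (-(K : ℤ)) K, 2 ≤ |k| → p k = 0 :=
  Summit.QuantumFields.YangMills.Theorems.CurvatureBoostCovariance.BoostsInheritMirrors.stub_levelGrowthLow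

/-- **Stub 5b — LEVEL GROWTH AT LEVELS `a ≥ 2`: THE TRANSFER `C⁺ = G_a`, the YM-specific input (USES THE TIE; difficulty XL;
THE BET of the line; = Stub 5 restricted to `a ≥ 2` at reshape 4).**  For every compact simple `G`, `r`, `sch` and `S₁` with
`W1 r sch S₁`, the eight frames and the cone, and every OS level `a ≥ 2`: IF `S₁` is already planar-invariant on `⁰𝒮` in all
degrees `N ≤ 2a - 2` (the induction hypothesis the composition supplies), THEN for every compactly supported `e₀`-time-ordered
`F` of degree `a` and every witness `H` of `ΘF* ⊗ F` whose orbit function is the trig polynomial with coefficients `p`, the layers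
`|k| ≥ 2` vanish.  Meaning: `Σ p_k e^{-4kχ} = ‖Ψ^χ_F‖²` (Stub 4) grows as `o(e^{8|χ|})` in both directions — "the ONE
mirror-adjacent pair of curvature insertions that the boost genuinely squeezes costs at most its dimension 4 + 4, softened", the
outer `a - 1` legs riding on boosts that are unitary by the induction hypothesis.  HONEST STATUS: no engine on record for `a ≥ 2`
(card + TRIAGE r1-2 doubt 2: light-cone / dyadic-in-energy form-factor growth from asymptotic freedom is where it should come
from); not refutable in any controlled scheme (Disproof §5–§6: c-number limits have constant orbit functions); false without the
tie (the zoo `Ĉ = (1+εe₂(p_μ²)²)/(p²+m²)`), exactly like the crux; implied outright by the crux's expected truth.  This registered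
statement is what a `promote-stub` would hand to the planners. -/
theorem stub_levelGrowthHigh :
    open Literature.MathematicalPhysics.QuantumLattice Literature.MathematicalPhysics.AQFT
      Literature.MathematicalPhysics.QuantumFieldTheory
      Summit.QuantumFields.YangMills.Theorems.CurvatureBoostCovariance.Negative
      Summit.QuantumFields.YangMills.Theorems.NPointIsotropy.Negative in
    ∀ (G : Type) [Group G] [TopologicalSpace G] [IsTopologicalGroup G] [CompactSpace G]
      [MeasurableSpace G] [BorelSpace G], IsCompactSimpleLieGroup G →
      ∀ (r : LatticeRep G) (sch : SpeciesScheme (YMSpecies G)) (S₁ : SchwingerFamily E4),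
        W1 r sch S₁ → EightFrameRP S₁ → PlanarCone S₁ →
        ∀ a : ℕ, 2 ≤ a →
          (∀ N : ℕ, N + 2 ≤ 2 * a → ∀ R : E4 ≃ₗᵢ[ℝ] E4,
            LinearMap.det (R.toLinearEquiv : E4 →ₗ[ℝ] E4) = 1 →
            R (EuclideanSpace.single 2 1) = EuclideanSpace.single 2 1 →
            R (EuclideanSpace.single 3 1) = EuclideanSpace.single 3 1 →
            ∀ F : SchwartzMap (Fin N → E4) ℂ, IsOffDiagonal F → S₁ N (linActMulti R F) = S₁ N F) →
          ∀ (F : SchwartzMap (Fin a → E4) ℂ), IsTimeOrdered F → HasCompactSupport (F : (Fin a → E4) → ℂ) →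
          ∀ H : SchwartzMap (Fin (a + a) → E4) ℂ, IsAppendTensorOf H (osAdjoint F) F →
          ∀ (K : ℕ) (p : ℤ → ℂ),
            (∀ θ : ℝ, S₁ (a + a) (linActMulti (planeRot (0 : Fin 3) θ) H) =
              ∑ k ∈ Finset.Icc (-(K : ℤ)) K, p k * Complex.exp (4 * (k : ℂ) * (θ : ℂ) * Complex.I)) →
            ∀ k ∈ Finset.Icc (-(K : ℤ)) K, 2 ≤ |k| → p k = 0 := by
  sorry

/-- **Stub 6a — TENSOR DENSITY (du Bois-Reymond for appended tensor products; pure analysis, model-blind;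
difficulty M; provable now; added by the lead at reshape 1, 2026-08-16).**  Let `U ⊆ (ℝ⁴)ⁿ`, `V ⊆ (ℝ⁴)ᵐ` be open and
`D` locally integrable on the appended product set `U ×' V = {x | (xᵢ)_{i<n} ∈ U ∧ (x_{n+j})_{j<m} ∈ V}`.  If
`∫ D · H = 0` for every appended tensor product `H = Φ ⊗ Ψ` (`IsAppendTensorOf`) of Schwartz functions `Φ`, `Ψ` with
compact supports inside `U`, `V`, then `∫ D · K = 0` for EVERY Schwartz `K` with compact support inside `U ×' V`
(equivalently `D = 0` a.e. on `U ×' V`).  Proof on offer: Stone–Weierstrass on a compact product neighbourhood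
`K₁ ×' L₁` of `tsupport K` (the *-algebra generated by restrictions of tensors `Φ ⊗ Ψ` of compactly supported
smooth functions separates points — `ContDiffBump`s — hence is dense in `C(K₁ ×' L₁, ℂ)`,
`ContinuousMap.starSubalgebra_topologicalClosure_eq_top_of_separatesPoints`); multiply the approximants by a fixed
cut-off tensor `χ_U ⊗ χ_V ≡ 1` on `tsupport K` (products of tensors are tensors, so each approximant is a finite sum
of admissible `H`'s, killed by hypothesis) and pass to the limit by dominated convergence (`D` integrable on
`K₁ ×' L₁`).  Alternative: Fubini + the one-factor du Bois-Reymond lemma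
`IsOpen.ae_eq_zero_of_integral_contDiff_smul_eq_zero` twice with a countable dense family.  This is the density step
of Stub 6 isolated as its own registered stub (the lead's reshape: Stub 6 consumes it as an explicit hypothesis). -/
theorem stub_tensorDensity :
    open Literature.MathematicalPhysics.QuantumLattice Literature.MathematicalPhysics.AQFT
      Literature.MathematicalPhysics.QuantumFieldTheory
      Summit.QuantumFields.YangMills.Theorems.CurvatureBoostCovariance.Negative
      Summit.QuantumFields.YangMills.Theorems.NPointIsotropy.Negative in
    ∀ (n m : ℕ) (U : Set (Fin n → E4)) (V : Set (Fin m → E4)), IsOpen U → IsOpen V →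
      ∀ D : (Fin (n + m) → E4) → ℂ,
        MeasureTheory.LocallyIntegrableOn D
          {x | (fun i => x (Fin.castAdd m i)) ∈ U ∧ (fun j => x (Fin.natAdd n j)) ∈ V} →
        (∀ (Φ : SchwartzMap (Fin n → E4) ℂ) (Ψ : SchwartzMap (Fin m → E4) ℂ),
          HasCompactSupport (Φ : (Fin n → E4) → ℂ) → tsupport (Φ : (Fin n → E4) → ℂ) ⊆ U →
          HasCompactSupport (Ψ : (Fin m → E4) → ℂ) → tsupport (Ψ : (Fin m → E4) → ℂ) ⊆ V →
          ∀ H : SchwartzMap (Fin (n + m) → E4) ℂ, IsAppendTensorOf H Φ Ψ →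
            ∫ x : Fin (n + m) → E4, D x * H x = 0) →
        ∀ K : SchwartzMap (Fin (n + m) → E4) ℂ, HasCompactSupport (K : (Fin (n + m) → E4) → ℂ) →
          tsupport (K : (Fin (n + m) → E4) → ℂ) ⊆
            {x | (fun i => x (Fin.castAdd m i)) ∈ U ∧ (fun j => x (Fin.natAdd n j)) ∈ V} →
          ∫ x : Fin (n + m) → E4, D x * K x = 0 :=
  Summit.QuantumFields.YangMills.Theorems.CurvatureBoostCovariance.BoostsInheritMirrors.stub_tensorDensity

/-- **Stub 6 — from doubled orbits to `⁰𝒮` (model-blind given Step 0; difficulty M–L; provable now; RESHAPED by the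
lead 2026-08-16: the tensor-density step is the explicit first hypothesis, discharged by Stub 6a in the composition).**  If every
`𝔖_N|⁰𝒮` is integration against a function `W_N` (Step 0), `S₁` is translation invariant on `⁰𝒮` and E3-symmetric
(inside `OSPackage`), and the orbit functions of ALL doubled test functions `ΘF* ⊗ G` with `deg F, deg G ≤ b`
(compact supports) are constant, then `S₁` is planar-invariant on `⁰𝒮` in every degree `N ≤ 2b`, under every
determinant-one isometry fixing `e₂, e₃` (verbatim the clause of `PlanarInvariant`).  Proof: such an `R` is
`planeRot 0 φ` (landed `PencilRigidityNPointIsotropyMopupHelpers`, `Mopup.exists_eq_planeRot`); for `N ≤ 2b` take the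
balanced cut `N = n + m`, `n, m ≤ b`; the witnesses of `ΘF* ⊗ G` over compactly supported time-ordered `F, G` contain
all products `φ ⊗ ψ`, `φ ∈ C_c^∞` (negative ordered chamber), `ψ ∈ C_c^∞` (positive ordered chamber), which determine
`L¹_loc` functions on the product chamber (Fubini + a countable dense family), so `D_φ := W_N ∘ R_φ - W_N = 0` a.e. on
the cut chamber; E3 (label permutations commute with the diagonal action) and translation invariance (`W_N(· + c) =
W_N` a.e. for each `c`; rational time-shifts suffice since chambers are open) spread this to the open conull set
`{x : x_i⁰ pairwise distinct}`; conclude with the landed a.e. change of variables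
`Mopup.apply_linActMulti_eq_of_generic` (`PencilRigidityNPointIsotropyMopup.lean`).  No density in `𝒮`, no continuity
across the exceptional set; false without the residual (`NPointIsotropy.Negative.PlanarGenericJunk`). -/
theorem stub_doubledToInvariant :
    open Literature.MathematicalPhysics.QuantumLattice Literature.MathematicalPhysics.AQFT
      Literature.MathematicalPhysics.QuantumFieldTheory
      Summit.QuantumFields.YangMills.Theorems.CurvatureBoostCovariance.Negative
      Summit.QuantumFields.YangMills.Theorems.NPointIsotropy.Negative in
    (∀ (n m : ℕ) (U : Set (Fin n → E4)) (V : Set (Fin m → E4)), IsOpen U → IsOpen V →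
      ∀ D : (Fin (n + m) → E4) → ℂ,
        MeasureTheory.LocallyIntegrableOn D
          {x | (fun i => x (Fin.castAdd m i)) ∈ U ∧ (fun j => x (Fin.natAdd n j)) ∈ V} →
        (∀ (Φ : SchwartzMap (Fin n → E4) ℂ) (Ψ : SchwartzMap (Fin m → E4) ℂ),
          HasCompactSupport (Φ : (Fin n → E4) → ℂ) → tsupport (Φ : (Fin n → E4) → ℂ) ⊆ U →
          HasCompactSupport (Ψ : (Fin m → E4) → ℂ) → tsupport (Ψ : (Fin m → E4) → ℂ) ⊆ V →
          ∀ H : SchwartzMap (Fin (n + m) → E4) ℂ, IsAppendTensorOf H Φ Ψ →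
            ∫ x : Fin (n + m) → E4, D x * H x = 0) →
        ∀ K : SchwartzMap (Fin (n + m) → E4) ℂ, HasCompactSupport (K : (Fin (n + m) → E4) → ℂ) →
          tsupport (K : (Fin (n + m) → E4) → ℂ) ⊆
            {x | (fun i => x (Fin.castAdd m i)) ∈ U ∧ (fun j => x (Fin.natAdd n j)) ∈ V} →
          ∫ x : Fin (n + m) → E4, D x * K x = 0) →
    ∀ (S₁ : SchwingerFamily E4), OSPackage S₁ → Translations S₁ → NPointRegular S₁ →
      ∀ b : ℕ,
        (∀ n m : ℕ, n ≤ b → m ≤ b →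
          ∀ (F : SchwartzMap (Fin n → E4) ℂ) (G : SchwartzMap (Fin m → E4) ℂ),
            IsTimeOrdered F → IsTimeOrdered G →
            HasCompactSupport (F : (Fin n → E4) → ℂ) → HasCompactSupport (G : (Fin m → E4) → ℂ) →
            ∀ H : SchwartzMap (Fin (n + m) → E4) ℂ, IsAppendTensorOf H (osAdjoint F) G →
              ∀ θ : ℝ, S₁ (n + m) (linActMulti (planeRot (0 : Fin 3) θ) H) = S₁ (n + m) H) →
        ∀ N : ℕ, N ≤ 2 * b → ∀ R : E4 ≃ₗᵢ[ℝ] E4,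
          LinearMap.det (R.toLinearEquiv : E4 →ₗ[ℝ] E4) = 1 →
          R (EuclideanSpace.single 2 1) = EuclideanSpace.single 2 1 →
          R (EuclideanSpace.single 3 1) = EuclideanSpace.single 3 1 →
          ∀ F : SchwartzMap (Fin N → E4) ℂ, IsOffDiagonal F → S₁ N (linActMulti R F) = S₁ N F :=
  Summit.QuantumFields.YangMills.Theorems.CurvatureBoostCovariance.BoostsInheritMirrors.stub_doubledToInvariant

/-! ## Checks against the landed negative / positive knowledge (imports live; sorry-free) -/

/-- Stub 2 is literally the shared item `MirrorModularBoosts.PlanarSpectralCone` (stmt-QuantumFields-9664), and that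
item, unfolded, is the eight-frame cone theorem over the landed vocabulary. -/
theorem planarSpectralCone_iff :
    Summit.QuantumFields.YangMills.Theses.MirrorModularBoosts.PlanarSpectralCone ↔
      ∀ S₁ : SchwingerFamily E4, S₁.toLabelled.HasLinearGrowth → S₁.toLabelled.IsSymmetric →
        Translations S₁ → EightFrameRP S₁ → PlanarCone S₁ :=
  Iff.rfl

/-- The natural strengthening "invariance as equality of functionals on all of `𝓢`" is FALSE (Disproof §4, landed):
every conclusion in this file keeps `IsOffDiagonal F` (`PlanarInvariant` verbatim). -/
example : ¬ CurvatureBoostCovarianceOnAllTests := not_curvatureBoostCovarianceOnAllTests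

/-- A band limit for ALL off-diagonal test functions WITHOUT the Step-0 residual is FALSE (junk family): stub 3
carries `NPointRegular S₁`, which junk violates. -/
example : ¬ Summit.QuantumFields.YangMills.Theorems.NPointIsotropy.Negative.Triage3.AngularBandLimit :=
  Summit.QuantumFields.YangMills.Theorems.NPointIsotropy.Negative.Triage3.not_AngularBandLimit

/-- Junk is excluded by the Step-0 residual (landed). -/
example : ¬ NPointRegular junk := not_nPointRegular_junk

/-- The Paley–Wiener lemma stub 3 leans on is LANDED (line `complex-rotation-bandlimit` of the sibling crux). -/
example : ∀ (Φ : ℂ → ℂ) (C N : ℝ) (K : ℕ), Differentiable ℂ Φ →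
    (∀ z : ℂ, Φ (z + (Real.pi / 2 : ℝ)) = Φ z) → (∀ z : ℂ, ‖Φ z‖ ≤ C * Real.exp (N * |z.im|)) →
    N < 4 * ((K : ℝ) + 1) →
    ∃ c : ℤ → ℂ, ∀ θ : ℝ,
      Φ θ = ∑ k ∈ Finset.Icc (-(K : ℤ)) K, c k * Complex.exp (4 * (k : ℂ) * (θ : ℂ) * Complex.I) :=
  Summit.QuantumFields.YangMills.Theorems.NPointIsotropy.ComplexRotationBandlimit.stub_bandlimit

/-! ## The parity sieve — the lever (ii): LANDED as `Theorems/MirrorModularBoostsCurvatureBoostCovarianceParitySieve.lean`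
(registered sub-goal `stub_paritySieve`, lead's reshape 5; the ~250-line `Sieve` section of the planner's skeleton moved there
verbatim) -/

/-- **THE PARITY SIEVE (the lever (ii); PROVED, landed).**  A 2×2 Laurent pencil `[[P,Q],[Q',R]](s)` that is positive
semidefinite for EVERY real `s ≠ 0` and whose diagonal entries have no layer `|k| ≥ 2` has constant off-diagonal entry. -/
theorem stub_paritySieve :
    ∀ (Kp Kq Kq' Kr : ℕ) (p q q' r : ℤ → ℂ),
      (∀ s : ℝ, s ≠ 0 → ∀ v w : ℂ,
        (fun z : ℂ => 0 ≤ z.re ∧ z.im = 0)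
          ((∑ k ∈ Finset.Icc (-(Kp : ℤ)) Kp, starRingEnd ℂ v * v * (p k * (s : ℂ) ^ k)) +
          (∑ k ∈ Finset.Icc (-(Kq : ℤ)) Kq, starRingEnd ℂ v * w * (q k * (s : ℂ) ^ k)) +
          (∑ k ∈ Finset.Icc (-(Kq' : ℤ)) Kq', starRingEnd ℂ w * v * (q' k * (s : ℂ) ^ k)) +
          (∑ k ∈ Finset.Icc (-(Kr : ℤ)) Kr, starRingEnd ℂ w * w * (r k * (s : ℂ) ^ k)))) →
      (∀ k ∈ Finset.Icc (-(Kp : ℤ)) Kp, 2 ≤ |k| → p k = 0) →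
      (∀ k ∈ Finset.Icc (-(Kr : ℤ)) Kr, 2 ≤ |k| → r k = 0) →
      ∀ k ∈ Finset.Icc (-(Kq : ℤ)) Kq, k ≠ 0 → q k = 0 :=
  Summit.QuantumFields.YangMills.Theorems.CurvatureBoostCovariance.BoostsInheritMirrors.stub_paritySieve

/-! ## Composition (pure logic): strong induction on the OS level -/

/-- The rotation by the angle `0` acts trivially on test functions. -/
theorem linActMulti_planeRot_zero {n : ℕ} (H : 𝓢((Fin n → E4), ℂ)) :
    linActMulti (planeRot (0 : Fin 3) 0) H = H := by
  ext x
  rw [linActMulti_apply]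
  congr 1
  funext i
  exact (planeRot (0 : Fin 3) 0).injective (by rw [LinearIsometryEquiv.apply_symm_apply, planeRot_zero_apply])

/-- **The model-blind sieve** (stubs 3, 4, 6 and the proved parity sieve, with the cone theorem, the Step-0 residual
and the level growth as HYPOTHESES): for a one-species family with the OS package, translations, proper hypercubic invariance, E2 in the eight
planar frames and the planar cone, IF every `𝔖ₙ|⁰𝒮` is a function and the level growth holds at every level, then
`S₁` is planar-invariant on `⁰𝒮`.  The lattice enters the crux only through the two hypotheses `hreg` (stub 1) and
`hgrow` (stub 5).  Proof: by induction on the level `a`, every doubled orbit function with `deg F, deg G ≤ a` is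
constant — the induction hypothesis and stub 6 give invariance in degrees `≤ 2a - 2`, stub 5 kills the layers
`|k| ≥ 2` of the two diagonal blocks, stub 4 gives positivity of the 2×2 pencil on `ℝ∖0`, `Sieve.paritySieve` makes
the `(F,G)` block constant; then stub 6 at level `N` gives degree `N`. -/
theorem sieve_of_stubs (S₁ : SchwingerFamily E4) (hOS : OSPackage S₁) (htr : Translations S₁)
    (hhyp : Hypercubic S₁) (h8 : EightFrameRP S₁) (hC : PlanarCone S₁)
    (hPSC : Summit.QuantumFields.YangMills.Theses.MirrorModularBoosts.PlanarSpectralCone)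
    (hreg : NPointRegular S₁)
    (hK : ∃ (K : E4 → ℝ) (C η : ℝ), 0 < η ∧ ContinuousOn K {x : E4 | x ≠ 0} ∧
      (∀ x : E4, x ≠ 0 → |K x| ≤ C * (1 + ‖x‖ ^ (η - 10))) ∧
      ∀ F : 𝓢((Fin 2 → E4), ℂ), IsOffDiagonal F →
        Integrable (fun x : Fin 2 → E4 => (K (x 0 - x 1) : ℂ) * F x) ∧
          S₁ 2 F = ∫ x : Fin 2 → E4, (K (x 0 - x 1) : ℂ) * F x)
    (hgrow : ∀ a : ℕ,
      (∀ N : ℕ, N + 2 ≤ 2 * a → ∀ R : E4 ≃ₗᵢ[ℝ] E4,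
        LinearMap.det (R.toLinearEquiv : E4 →ₗ[ℝ] E4) = 1 →
        R (EuclideanSpace.single 2 1) = EuclideanSpace.single 2 1 →
        R (EuclideanSpace.single 3 1) = EuclideanSpace.single 3 1 →
        ∀ F : 𝓢((Fin N → E4), ℂ), IsOffDiagonal F → S₁ N (linActMulti R F) = S₁ N F) →
      ∀ (F : 𝓢((Fin a → E4), ℂ)), IsTimeOrdered F → HasCompactSupport (F : (Fin a → E4) → ℂ) →
      ∀ H : 𝓢((Fin (a + a) → E4), ℂ), IsAppendTensorOf H (osAdjoint F) F →
      ∀ (K : ℕ) (p : ℤ → ℂ),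
        (∀ θ : ℝ, S₁ (a + a) (linActMulti (planeRot (0 : Fin 3) θ) H) =
          ∑ k ∈ Finset.Icc (-(K : ℤ)) K, p k * Complex.exp (4 * (k : ℂ) * (θ : ℂ) * Complex.I)) →
        ∀ k ∈ Finset.Icc (-(K : ℤ)) K, 2 ≤ |k| → p k = 0) :
    PlanarInvariant S₁ := by
  have hlg : S₁.toLabelled.HasLinearGrowth := hOS.2.2.1
  have hsym : S₁.toLabelled.IsSymmetric := hOS.2.2.2.2.1
  -- local boost vectors for `S₁` (every `e₀`-reconstruction) …
  have hbv := fun h : OSReconstructionNoE1 S₁.toLabelled => uniformPlanarBoostVectors_local S₁ h hlg hsym h8 hC hK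
  -- … and for its 45° pull-back (again an eight-frame family with the cone and the transported kernel)
  have hbvT := fun h' : OSReconstructionNoE1
      (SchwingerFamily.toLabelled (fun n => (S₁ n).comp (linActMulti (planeRot (0 : Fin 3) (Real.pi / 4))))) =>
    uniformPlanarBoostVectors_local (fun n => (S₁ n).comp (linActMulti (planeRot (0 : Fin 3) (Real.pi / 4)))) h'
      (Summit.QuantumFields.YangMills.Theorems.CurvatureBoostCovariance.BoostsInheritMirrors.RayPositivity.hasLinearGrowth_pullBack hlg _)
      (Summit.QuantumFields.YangMills.Theorems.CurvatureBoostCovariance.BoostsInheritMirrors.RayPositivity.isSymmetric_pullBack hsym _)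
      (Summit.QuantumFields.YangMills.Theorems.CurvatureBoostCovariance.BoostsInheritMirrors.RayPositivity.eightFrameRP_pullBack h8)
      (Summit.QuantumFields.YangMills.Theorems.CurvatureBoostCovariance.BoostsInheritMirrors.RayPositivity.planarCone_pullBack hPSC hlg hsym htr h8)
      (kernelTriple_pullBack _ hK)
  have hband := Summit.QuantumFields.YangMills.Theorems.SoftKernelBoostCovariance.Sketch.stub_orbitBandlimitLocal
    S₁ hOS htr hhyp h8 hC hreg hbv
  have hpos := Summit.QuantumFields.YangMills.Theorems.SoftKernelBoostCovariance.Sketch.stub_rayPositivityLocal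
    S₁ hOS htr h8 (fun h => boostVectors_of_uniform_local (hbv h)) (fun h' => boostVectors_of_uniform_local (hbvT h'))
  have hd2i := stub_doubledToInvariant stub_tensorDensity S₁ hOS htr hreg
  -- one level of the induction: invariance below `2a - 1` ⇒ doubled-orbit constancy up to level `a`
  have level_step : ∀ a : ℕ,
      (∀ N : ℕ, N + 2 ≤ 2 * a → ∀ R : E4 ≃ₗᵢ[ℝ] E4,
        LinearMap.det (R.toLinearEquiv : E4 →ₗ[ℝ] E4) = 1 →
        R (EuclideanSpace.single 2 1) = EuclideanSpace.single 2 1 →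
        R (EuclideanSpace.single 3 1) = EuclideanSpace.single 3 1 →
        ∀ F : 𝓢((Fin N → E4), ℂ), IsOffDiagonal F → S₁ N (linActMulti R F) = S₁ N F) →
      ∀ n m : ℕ, n ≤ a → m ≤ a →
        ∀ (F : 𝓢((Fin n → E4), ℂ)) (G : 𝓢((Fin m → E4), ℂ)),
          IsTimeOrdered F → IsTimeOrdered G →
          HasCompactSupport (F : (Fin n → E4) → ℂ) → HasCompactSupport (G : (Fin m → E4) → ℂ) →
          ∀ H : 𝓢((Fin (n + m) → E4), ℂ), IsAppendTensorOf H (osAdjoint F) G →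
            ∀ θ : ℝ, S₁ (n + m) (linActMulti (planeRot (0 : Fin 3) θ) H) = S₁ (n + m) H := by
    intro a hInv n m hn hm F G hF hG hFc hGc H hH θ
    -- the four doubled blocks and their trigonometric data (stub 3)
    obtain ⟨HFF, hHFF⟩ := exists_isAppendTensorOf (osAdjoint F) F
    obtain ⟨HGF, hHGF⟩ := exists_isAppendTensorOf (osAdjoint G) F
    obtain ⟨HGG, hHGG⟩ := exists_isAppendTensorOf (osAdjoint G) G
    obtain ⟨Kp, p, hp⟩ := hband n n F F hF hF hFc hFc HFF hHFF
    obtain ⟨Kq, q, hq⟩ := hband n m F G hF hG hFc hGc H hH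
    obtain ⟨Kq', q', hq'⟩ := hband m n G F hG hF hGc hFc HGF hHGF
    obtain ⟨Kr, r, hr⟩ := hband m m G G hG hG hGc hGc HGG hHGG
    -- boost inheritance (stub 4): the pencil is PSD on both half-lines
    have hpsd := hpos n m F G hF hG hFc hGc HFF H HGF HGG hHFF hH hHGF hHGG Kp Kq Kq' Kr p q q' r hp hq hq' hr
    -- level growth (stub 5) at the levels `n` and `m`: no diagonal layer `|k| ≥ 2`
    have hp2 : ∀ k ∈ Finset.Icc (-(Kp : ℤ)) Kp, 2 ≤ |k| → p k = 0 :=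
      hgrow n (fun N hN => hInv N (by omega)) F hF hFc HFF hHFF Kp p hp
    have hr2 : ∀ k ∈ Finset.Icc (-(Kr : ℤ)) Kr, 2 ≤ |k| → r k = 0 :=
      hgrow m (fun N hN => hInv N (by omega)) G hG hGc HGG hHGG Kr r hr
    -- parity + Cauchy–Schwarz (the proved sieve): the `(F,G)` block is constant
    have hq0 : ∀ k ∈ Finset.Icc (-(Kq : ℤ)) Kq, k ≠ 0 → q k = 0 :=
      stub_paritySieve Kp Kq Kq' Kr p q q' r hpsd hp2 hr2
    calc S₁ (n + m) (linActMulti (planeRot (0 : Fin 3) θ) H)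
        = ∑ k ∈ Finset.Icc (-(Kq : ℤ)) Kq, q k * Complex.exp (4 * (k : ℂ) * (θ : ℂ) * Complex.I) := hq θ
      _ = ∑ k ∈ Finset.Icc (-(Kq : ℤ)) Kq,
            q k * Complex.exp (4 * (k : ℂ) * ((0 : ℝ) : ℂ) * Complex.I) := by
          refine Finset.sum_congr rfl fun k hk => ?_
          by_cases hk0 : k = 0
          · subst hk0; simp
          · rw [hq0 k hk hk0]; simp
      _ = S₁ (n + m) (linActMulti (planeRot (0 : Fin 3) 0) H) := (hq 0).symm
      _ = S₁ (n + m) H := by rw [linActMulti_planeRot_zero]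
  -- the induction on the level
  have hQ : ∀ a n m : ℕ, n ≤ a → m ≤ a →
      ∀ (F : 𝓢((Fin n → E4), ℂ)) (G : 𝓢((Fin m → E4), ℂ)),
        IsTimeOrdered F → IsTimeOrdered G →
        HasCompactSupport (F : (Fin n → E4) → ℂ) → HasCompactSupport (G : (Fin m → E4) → ℂ) →
        ∀ H : 𝓢((Fin (n + m) → E4), ℂ), IsAppendTensorOf H (osAdjoint F) G →
          ∀ θ : ℝ, S₁ (n + m) (linActMulti (planeRot (0 : Fin 3) θ) H) = S₁ (n + m) H := by
    intro a
    induction a with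
    | zero => exact level_step 0 fun N hN => absurd hN (by omega)
    | succ a ih => exact level_step (a + 1) fun N hN => hd2i a ih N (by omega)
  -- every degree
  intro R hdet h2 h3 N F hF
  exact hd2i N (hQ N) N (by omega) R hdet h2 h3 F hF

/-- **The skeleton**: the six stubs prove `MirrorModularBoosts.CurvatureBoostCovariance` (concluded BY NAME; the
only sorries are the open stubs).  The crux's own cone `hC` feeds stubs 1, 3, 4 (axis rays) and 5; the diagonal
rays of stub 4 consume the cone THEOREM (stub 2 = item 9664) for the 45° pull-backs. -/
theorem CurvatureBoostCovariance_of :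
    Summit.QuantumFields.YangMills.Theses.MirrorModularBoosts.CurvatureBoostCovariance := by
  rw [crux_iff]
  intro G _ _ _ _ hG
  letI : MeasurableSpace G := borel G
  haveI : BorelSpace G := ⟨rfl⟩
  intro r sch S₁ hW h8 hC
  -- Step 0 (the tie): every 𝔖ₙ|⁰𝒮 of the tied family is a function
  have hreg : NPointRegular S₁ := stub_tieRegularity G hG r sch S₁ hW h8 hC
  -- the two-point kernel triple (item 11687, by name)
  have hK := stub_curvatureKernelBound G hG r sch S₁ hW
  -- the transfer (the tie again): level growth
  have hlow := stub_levelGrowthLow stub_curvatureKernelBound stub_shellRigidity G hG r sch S₁ hW h8 hC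
  have hhigh := stub_levelGrowthHigh G hG r sch S₁ hW h8 hC
  have hgrow : ∀ a : ℕ,
      (∀ N : ℕ, N + 2 ≤ 2 * a → ∀ R : E4 ≃ₗᵢ[ℝ] E4,
        LinearMap.det (R.toLinearEquiv : E4 →ₗ[ℝ] E4) = 1 →
        R (EuclideanSpace.single 2 1) = EuclideanSpace.single 2 1 →
        R (EuclideanSpace.single 3 1) = EuclideanSpace.single 3 1 →
        ∀ F : 𝓢((Fin N → E4), ℂ), IsOffDiagonal F → S₁ N (linActMulti R F) = S₁ N F) →
      ∀ (F : 𝓢((Fin a → E4), ℂ)), IsTimeOrdered F → HasCompactSupport (F : (Fin a → E4) → ℂ) →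
      ∀ H : 𝓢((Fin (a + a) → E4), ℂ), IsAppendTensorOf H (osAdjoint F) F →
      ∀ (K : ℕ) (p : ℤ → ℂ),
        (∀ θ : ℝ, S₁ (a + a) (linActMulti (planeRot (0 : Fin 3) θ) H) =
          ∑ k ∈ Finset.Icc (-(K : ℤ)) K, p k * Complex.exp (4 * (k : ℂ) * (θ : ℂ) * Complex.I)) →
        ∀ k ∈ Finset.Icc (-(K : ℤ)) K, 2 ≤ |k| → p k = 0 := by
    intro a
    by_cases ha : a ≤ 1
    · exact hlow a ha
    · exact hhigh a (by omega)
  obtain ⟨-, hOS, htr, hhyp, -⟩ := hW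
  -- the model-blind sieve
  exact sieve_of_stubs S₁ hOS htr hhyp h8 hC stub_planarCone hreg hK hgrow

/-! ## The repaired route's engine crux `SoftKernelBoostCovariance` (stmt-QuantumFields-14999, judge repair 2026-08-16)
from the SAME stubs minus `stub_curvatureKernelBound` (the kernel triple is its extra hypothesis) -/

/-- **The engine-below-dimension-five crux, unbundled** (definitional): `SoftKernelBoostCovariance` is, for every compact
simple `G` (Borel σ-algebra), `W1 r sch S₁ → EightFrameRP S₁ → PlanarCone S₁ → (kernel triple of S₁ 2) → PlanarInvariant S₁`. -/
theorem softKernelBoostCovariance_iff :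
    Summit.QuantumFields.YangMills.Theses.MirrorModularBoosts.SoftKernelBoostCovariance ↔
      ∀ (G : Type) [Group G] [TopologicalSpace G] [IsTopologicalGroup G] [CompactSpace G],
        IsCompactSimpleLieGroup G →
        letI : MeasurableSpace G := borel G
        haveI : BorelSpace G := ⟨rfl⟩
        ∀ (r : LatticeRep G) (sch : SpeciesScheme (YMSpecies G)) (S₁ : SchwingerFamily E4),
          W1 r sch S₁ → EightFrameRP S₁ → PlanarCone S₁ →
          (∃ (K : E4 → ℝ) (C η : ℝ), 0 < η ∧ ContinuousOn K {x : E4 | x ≠ 0} ∧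
            (∀ x : E4, x ≠ 0 → |K x| ≤ C * (1 + ‖x‖ ^ (η - 10))) ∧
            ∀ F : 𝓢((Fin 2 → E4), ℂ), IsOffDiagonal F →
              MeasureTheory.Integrable (fun x : Fin 2 → E4 => (K (x 0 - x 1) : ℂ) * F x) ∧
                S₁ 2 F = ∫ x : Fin 2 → E4, (K (x 0 - x 1) : ℂ) * F x) →
          PlanarInvariant S₁ :=
  Iff.rfl

/-- **Level growth at levels `a ≤ 1` from the KERNEL TRIPLE of `S₁` itself** (instead of the global `CurvatureKernelBound`):
the triple + the landed `KernelTransfer` + `stub_shellRigidity` make the two-point kernel radial, so the degree-`2` doubled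
orbit is constant and its non-zero layers vanish (`trigPoly_coeff_eq_zero_of_const`, landed with Stub 5a); `a = 0` is trivial. -/
theorem levelGrowthLow_of_kernel (hSR : Summit.QuantumFields.YangMills.Theses.PencilRigidity.ShellRigidity)
    {G : Type} [Group G] [TopologicalSpace G] [IsTopologicalGroup G] [CompactSpace G] [MeasurableSpace G] [BorelSpace G]
    {r : LatticeRep G} {sch : SpeciesScheme (YMSpecies G)} {S₁ : SchwingerFamily E4}
    (hW : W1 r sch S₁) (h8 : EightFrameRP S₁)
    (hK : ∃ (K : E4 → ℝ) (C η : ℝ), 0 < η ∧ ContinuousOn K {x : E4 | x ≠ 0} ∧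
      (∀ x : E4, x ≠ 0 → |K x| ≤ C * (1 + ‖x‖ ^ (η - 10))) ∧
      ∀ F : 𝓢((Fin 2 → E4), ℂ), IsOffDiagonal F →
        MeasureTheory.Integrable (fun x : Fin 2 → E4 => (K (x 0 - x 1) : ℂ) * F x) ∧
          S₁ 2 F = ∫ x : Fin 2 → E4, (K (x 0 - x 1) : ℂ) * F x) :
    ∀ a : ℕ, a ≤ 1 →
      ∀ (F : 𝓢((Fin a → E4), ℂ)), IsTimeOrdered F →
      ∀ H : 𝓢((Fin (a + a) → E4), ℂ), IsAppendTensorOf H (osAdjoint F) F →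
      ∀ (K : ℕ) (p : ℤ → ℂ),
        (∀ θ : ℝ, S₁ (a + a) (linActMulti (planeRot (0 : Fin 3) θ) H) =
          ∑ k ∈ Finset.Icc (-(K : ℤ)) K, p k * Complex.exp (4 * (k : ℂ) * (θ : ℂ) * Complex.I)) →
        ∀ k ∈ Finset.Icc (-(K : ℤ)) K, 2 ≤ |k| → p k = 0 := by
  intro a ha F hF H hH K p hp
  have hconst : ∀ θ : ℝ, S₁ (a + a) (linActMulti (planeRot (0 : Fin 3) θ) H) = S₁ (a + a) H := by
    obtain rfl | rfl : a = 0 ∨ a = 1 := by omega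
    · intro θ
      congr 1
      ext x
      rw [linActMulti_apply]
      congr 1
      funext i
      exact Fin.elim0 i
    · obtain ⟨Kf, C, η, hη, hKc, hKb, hKrep⟩ := hK
      obtain ⟨-, hOS, -, hhyp, -⟩ := hW
      obtain ⟨hWB4, hax, hdiag⟩ :=
        Summit.QuantumFields.YangMills.Theorems.KernelTransfer.kernelTransfer_proof S₁ Kf hKc hKrep hOS.2.2.2.2.1 hhyp h8
      have hrad : Summit.QuantumFields.YangMills.Theorems.NPointIsotropy.Negative.RadialKernel S₁ :=
        ⟨Kf, hKc, fun R x hx => hSR Kf hKc ⟨C, η, hη, hKb⟩ hWB4 hax hdiag R x hx, hKrep⟩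
      have hHoff : IsOffDiagonal H := hH.isOffDiagonal_of_isTimeOrdered hF hF
      intro θ
      exact Summit.QuantumFields.YangMills.Theorems.NPointIsotropy.Negative.radialKernel_invariant_two hrad
        (planeRot (0 : Fin 3) θ) H hHoff
  intro k hk hk2
  have hk0 : k ≠ 0 := by
    rintro rfl
    rw [abs_zero] at hk2
    exact absurd hk2 (by norm_num)
  exact Summit.QuantumFields.YangMills.Theorems.CurvatureBoostCovariance.BoostsInheritMirrors.trigPoly_coeff_eq_zero_of_const
    K p (S₁ (a + a) H) (fun θ => (hp θ).symm.trans (hconst θ)) k hk hk0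

/-- **The skeleton ALSO proves the repaired engine crux `SoftKernelBoostCovariance` (stmt-QuantumFields-14999) BY NAME**,
modulo the stubs of this line MINUS `stub_curvatureKernelBound` (judge repair 2026-08-16: `KernelBoundEngineGlue` =
`CurvatureKernelBound → SoftKernelBoostCovariance → CurvatureBoostCovariance`, so 9663 follows from 11687 and this theorem).
Open inputs here: `stub_tieRegularity`, `stub_planarCone` (9664), `stub_uniformPlanarBoostVectors`, `stub_shellRigidity` (11685),
`stub_levelGrowthHigh`. -/
theorem SoftKernelBoostCovariance_of :
    Summit.QuantumFields.YangMills.Theses.MirrorModularBoosts.SoftKernelBoostCovariance := by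
  rw [softKernelBoostCovariance_iff]
  intro G _ _ _ _ hG
  letI : MeasurableSpace G := borel G
  haveI : BorelSpace G := ⟨rfl⟩
  intro r sch S₁ hW h8 hC hK
  have hreg : NPointRegular S₁ := stub_tieRegularity G hG r sch S₁ hW h8 hC
  have hlow := levelGrowthLow_of_kernel stub_shellRigidity hW h8 hK
  have hhigh := stub_levelGrowthHigh G hG r sch S₁ hW h8 hC
  have hgrow : ∀ a : ℕ,
      (∀ N : ℕ, N + 2 ≤ 2 * a → ∀ R : E4 ≃ₗᵢ[ℝ] E4,
        LinearMap.det (R.toLinearEquiv : E4 →ₗ[ℝ] E4) = 1 →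
        R (EuclideanSpace.single 2 1) = EuclideanSpace.single 2 1 →
        R (EuclideanSpace.single 3 1) = EuclideanSpace.single 3 1 →
        ∀ F : 𝓢((Fin N → E4), ℂ), IsOffDiagonal F → S₁ N (linActMulti R F) = S₁ N F) →
      ∀ (F : 𝓢((Fin a → E4), ℂ)), IsTimeOrdered F → HasCompactSupport (F : (Fin a → E4) → ℂ) →
      ∀ H : 𝓢((Fin (a + a) → E4), ℂ), IsAppendTensorOf H (osAdjoint F) F →
      ∀ (K : ℕ) (p : ℤ → ℂ),
        (∀ θ : ℝ, S₁ (a + a) (linActMulti (planeRot (0 : Fin 3) θ) H) =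
          ∑ k ∈ Finset.Icc (-(K : ℤ)) K, p k * Complex.exp (4 * (k : ℂ) * (θ : ℂ) * Complex.I)) →
        ∀ k ∈ Finset.Icc (-(K : ℤ)) K, 2 ≤ |k| → p k = 0 := by
    intro a
    by_cases ha : a ≤ 1
    · intro _ F hF _ H hH K p hp
      exact hlow a ha F hF H hH K p hp
    · exact hhigh a (by omega)
  obtain ⟨-, hOS, htr, hhyp, -⟩ := hW
  exact sieve_of_stubs S₁ hOS htr hhyp h8 hC stub_planarCone hreg hK hgrow

end Summit.QuantumFields.YangMills.Cruxes.CurvatureBoostCovariance.BoostsInheritMirrors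

end
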